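import Mathlib
import HarnessLib

/-!
# Hintz 2026, §3.3: the Kerr (dual) metric in the coordinates `(t̃_*, r, θ, φ)` / `(t_*, r, θ, φ)` (displays
# before Lemma 3.6 and eq. (3.17) `EqKMetFinal`), the reference metrics of Def. 3.9, the `r⁻²`-asymptotics
# of Prop. 3.10 / eq. (3.21) `EqKMetDiff` for the dual AND the covariant metrics, and the Euclidean identities
# (3.22) `EqKMetaExpr` — kernel reproduction for ALL parameters `(𝔪, a)`

#harness_tags [topic Geometry/Lorentzian]

CITATION HEADER (lean-in-tree rule 2026-08-18).  P. Hintz, *Nonlinear stability of subextremal Kerr black holes*,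
arXiv:2606.28253 **v2** (2026-08-03), bib key `Hintz2026` — an UNREFEREED CLAIM under adjudication in this library
(`Literature.Geometry.Lorentzian.hintz_kerr_stability_subextremal_cauchy` carries its main theorem as
`@[claim "Hintz2026" "under-review"]`); "H l.N" = line N of the v2 TeX source `kerr-stab-r.tex` (md5 2c6513182847),
equation / page numbers those of the v2 PDF.  Written by the audit cell `pub-kerr` (HINTZ-PLAN.md P35; GAPS.md C-A19);
nothing in this file is a stability statement or an estimate: it is finite algebra on explicitly printed coordinate
expressions of the Kerr metric, valid for every real `𝔪`, `a` (no smallness — not even sub-extremality — is used).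

## What is printed (H §3.3 "Kerr metrics; linearizations; initial data", v2 PDF pp. 71–74)

* Boyer–Lindquist form (H l.3586–3592, p.71): `μ = r² − 2𝔪r + a²`, `ϱ² = r² + a²cos²θ`,
  `g_{𝔪,a} = −(μ/ϱ²)(d𝔱 − a sin²θ dϕ)² + ϱ²(dr²/μ + dθ²) + (sin²θ/ϱ²)((r²+a²)dϕ − a d𝔱)²`,
  `ϱ² g⁻¹_{𝔪,a} = −μ⁻¹((r²+a²)∂_𝔱 + a∂_ϕ)² + μ∂_r² + ∂_θ² + sin⁻²θ(∂_ϕ + a sin²θ ∂_𝔱)²`.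
* New coordinates (3.11) `EqKMetTstar` (H l.3608–3612): `t̃_* = 𝔱 + T_{𝔪,a}(r)`, `T′ = (χ_{𝓗⁺} − χ_∞)(r²+a²)/μ`;
  `φ = ϕ + Φ_{𝔪,a}(r)`, `Φ′ = χ_{𝓗⁺} a/μ`; cut-offs of DISJOINT support (`χ_{𝓗⁺} ∈ C_c^∞([0,4𝔪₀))`, `χ_∞ = 0` on
  `[0,4𝔪₀]`, H l.3602–3605), so `χ_{𝓗⁺}·χ_∞ ≡ 0`.  "We then compute" (H l.3620–3626, pp.71–72) the covariant metric
  `g = −(μ/ϱ²)(dt̃_*−a sin²θdφ)² + [(1−χ_{𝓗⁺}²)ϱ²/μ − χ_∞²(r²+a²)²(μ−a²sin²θ)/(ϱ²μ²)]dr² + ϱ²dθ² + 2χ_{𝓗⁺}(dt̃_*−a sin²θdφ)⊗_sdr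
  + (sin²θ/ϱ²)((r²+a²)dφ − a dt̃_*)² − 2χ_∞[((r²+a²)(μ−a²sin²θ)/(ϱ²μ))dt̃_*dr + (2a𝔪r(r²+a²)sin²θ/(ϱ²μ))dφ dr]`
  and the dual metric `ϱ²g⁻¹ = −((1−χ_{𝓗⁺}²)/μ)((r²+a²)∂_{t̃_*} + a∂_φ)² + μ∂_r² + ∂_θ² + sin⁻²θ(∂_φ + a sin²θ∂_{t̃_*})²
  + 2χ_{𝓗⁺}((r²+a²)∂_{t̃_*} + a∂_φ)⊗_s∂_r − 2χ_∞(r²+a²)∂_{t̃_*}⊗_s∂_r + χ_∞²((r²+a²)²/μ)∂²_{t̃_*}`.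
* Lemma 3.6 `LemmaKMetTime` (H l.3629–3667, p.72): `t_* := t̃_* + T̃(r)` (3.13), `T̃′ = C r⁻²` for large `r`; its proof
  computes (3.14) `EqKMetTimeNorm` (H l.3647) `ϱ²g⁻¹(dt_*,dt_*) = 2(r²+a²)T̃′ + μT̃′² + a²sin²θ` (`r ≤ 3𝔪₀`), and for
  `r ≥ 5𝔪₀` (H l.3651) `= −2(r²+a²)T̃′ + μT̃′² + a²sin²θ`, i.e. at `T̃′ = Cr⁻²` eq. (3.16) `EqKMetTime2` (H l.3662; there
  "a r⁻⁴" is printed for "a² r⁻⁴", the cell's earlier datum SRC-A15).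
* (3.17) `EqKMetFinal` (H l.3668–3676, p.72): "The dual metric in the coordinates `t_*, r, θ, φ` thus reads"
  `ϱ²g⁻¹ = −((1−χ_{𝓗⁺}²)/μ)((r²+a²)∂_{t_*} + a∂_φ)² + μ∂_r² + ∂_θ² + sin⁻²θ(∂_φ + a sin²θ ∂_{t_*})²
  + 2χ_{𝓗⁺}((r²+a²)∂_{t_*} + a∂_φ)⊗_s(∂_r + T̃′∂_{t_*}) − 2χ_∞(r²+a²)∂_{t_*}⊗_s(∂_r + T̃′∂_{t_*}) + χ_∞²((r²+a²)²/μ)∂²_{t_*}`;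
  Def. 3.8 `DefKMetcM` (H l.3712–3722, p.73) DEFINES `g_{𝔪,𝔞}` on `𝓜` "via its dual metric by (3.17), i.e., the
  metric `g_{𝔪,a}` in the coordinates `t_*`, `r`, `θ`, `φ`".
* Def. 3.9 `DefKMetRef` (H l.3724–3734, pp.73–74), (3.19): `g_𝔪 := −(1−2𝔪/r)dt_*² − 2dt_*dr + r²g̸`,
  `g_𝔪⁻¹ = −2∂_{t_*}⊗_s∂_r + (1−2𝔪/r)∂_r² + r⁻²g̸⁻¹`; `g̲ := g_0`.
* Prop. 3.10 `PropKMetCpt` (H l.3735–3749, p.74), (3.21) `EqKMetDiff`: `g_{𝔪,𝔞} − g_𝔪 ∈ r⁻²C^∞(M;S²𝒯*)`,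
  `g_𝔪 − g̲ = (2𝔪/r)dt_*² ∈ r⁻¹C^∞`, "similarly for the dual metrics".  Proof (H l.3751–3775): at large `r`
  (`χ_{𝓗⁺} = 0`, `χ_∞ = 1`), with the smooth generators `∂_{t_*}, ∂_r ∈ C^∞(M;𝒯)`, `a∂_φ ∈ rC^∞(M;𝒯)`, `a cosθ`,
  `a²sin²θ ∈ C^∞(M)`, functions smooth in `ρ = r⁻¹`, and `∂_θ² + sin⁻²θ∂_φ² ∈ r²C^∞(M;S²𝒯)`; "the `∂_{t_*}⊗_s a∂_φ`-terms
  cancel modulo `r⁻²C^∞(M;S²𝒯)`, and the `∂²_{t_*}`-terms cancel as well" (H l.3774).  The smoothness of `a∂_φ`, `a cosθ`,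
  `a²sin²θ` (in `x` AND in `𝔞 ∈ ℝ³`, near `𝔞 = 0` included) rests on (3.22) `EqKMetaExpr` (H l.3753–3758):
  "`a∂_φ = ∇_{𝔞×x}`, `a cosθ = 𝔞·x/|x|`, `a²sin²θ = |𝔞|² − (𝔞·x/|x|)²` where the polar coordinates `θ, φ` are adapted to
  `𝔞 ∈ ℝ³` (with `a = |𝔞|`) as in Definition 3.8" (north pole `θ = 0` at `𝔞/|𝔞|`, H l.3714).  The COVARIANT half of (3.21) is
  what Prop. 3.10 states; its printed proof treats the dual metric only ("similarly for the dual metrics", H l.3749, read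
  the other way): the covariant statement follows by inversion, `g − g_𝔪 = −g·(g⁻¹ − g_𝔪⁻¹)·g_𝔪`.

## Conventions of this file

All tensors are COMPONENT MATRICES in the coordinate frame `(∂_t, ∂_r, ∂_θ, ∂_φ)` (index `0,1,2,3`; `t` = the time
coordinate of the chart at hand: `𝔱`, `t̃_*`, or `t_*`) resp. the coframe `(dt, dr, dθ, dφ)`; `2u⊗_sv` has the matrix
`uvᵀ + vuᵀ`.  `s2 := sin²θ`, and `ϱ² = r² + a²(1 − s2)`.  Every printed display is transcribed as the explicit matrix of
its entries; the docstrings say which printed term produces which entry.  The chain rule for (3.11) / (3.13): if the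
old basis vector `∂_r^{old} = ∂_r + T′∂_t + Φ′∂_φ` (the other basis vectors unchanged), a contravariant 2-tensor with
old matrix `Q` has new matrix `J Q Jᵀ` with `J = J1 T′ Φ′` (`pullJ1`), and a covariant one `Kᵀ G K` with `K = K1 T′ Φ′`
(`d𝔱 = dt̃_* − T′dr`, `dϕ = dφ − Φ′dr`; `pullK1`).

## What is proved here (for ALL real `𝔪, a, r, s2, χH, χI, …`; non-vanishing of `μ`, `s2`, `ϱ²`, `r` only where divided by)

1. `tilde_dual_display` : the BL dual metric pulled back under (3.11) equals the printed `(t̃_*)` dual display plus the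
   cross term `CrossHI` (`tt`: `−2χ_{𝓗⁺}χ_∞(r²+a²)²/μ`, `tφ`: `−χ_{𝓗⁺}χ_∞a(r²+a²)/μ`), which vanishes wherever
   `χ_{𝓗⁺}χ_∞ = 0`, i.e. everywhere (`tilde_dual_display_of_disjoint`); `tilde_covariant_display` : likewise for the
   covariant display (cross term `2χ_{𝓗⁺}χ_∞(r²+a²)/μ · dr²`).  The printed `(t̃_*)` displays are CORRECT.
2. `eqKMetFinal_defect` : transporting the `(t̃_*)` display by (3.13) (`∂_r ↦ ∂_r + T̃′∂_{t_*}`; `Qstar_eq_pullback`)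
   gives (3.17) PLUS `μ·(2T̃′ ∂_{t_*}⊗_s∂_r + T̃′² ∂²_{t_*})`: the printed (3.17) carries the shift in its two cross terms
   but NOT in `μ∂_r²`, which should read `μ(∂_r + T̃′∂_{t_*})²` — audit datum **SRC-A39**.  The paper's OWN computations
   use the correct form: `timeNorm_interior` = (3.14) (with `μT̃′²`), `timeNorm_far` / `timeNorm_far_C` = the `r ≥ 5𝔪₀`
   line and (3.16), while `printed_timeNorm_interior` shows that (3.17)-as-printed would give `2(r²+a²)T̃′ + a²sin²θ`.
   NIL: Def. 3.8's "i.e." clause pins the intended tensor, and at large `r` the omitted terms are of class `r⁻²C^∞`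
   (`defect_far_coefficients`) — the class modulo which Prop. 3.10 computes; the uses of (3.17) (H l.3714, 3752, 3763,
   3769, 7073) do not depend on them.  `timeNorm_at_BL`, `bl_time_norm_neg` : H l.3641–3642 / l.3649.
3. Prop. 3.10 / (3.21) for the dual metrics, for ALL `(𝔪, a)`: with `D := g⁻¹_{𝔪,a} − g_𝔪⁻¹` at large `r` (correct
   `(t_*)` form, `T̃′ = Cr⁻²`; `D_eq`), the components of `D` in closed form over `(μ, ϱ², r, sin²θ)` — `D_tt`, `D_tr`,
   `D_rr`, `D_tφ`, `D_angular`, `D_offdiag_zero` — and, via the dictionary `μ = r²(1−2𝔪ρ+a²ρ²)`, `ϱ² = r²(1+c2ρ²)`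
   (`mu_rho`, `rhoSq_rho`; `ρ = r⁻¹`, `c2 = a²cos²θ`), the statement `D_rho_forms`: every coefficient of `D` on the proof's
   smooth generators (`∂²_{t_*}`, `2∂_{t_*}⊗_s∂_r`, `∂_r²`, `2∂_{t_*}⊗_s(a∂_φ/r)` — no division by `a` —,
   `r⁻²(∂_θ²+sin⁻²θ∂_φ²)`, `(a∂_φ/r)²`) is `ρ²·F(ρ)` with `F` rational, denominators `(1 + c2ρ²)` or
   `(1 − 2𝔪ρ + a²ρ²)(1 + c2ρ²)`, finite at `ρ = 0` (`F_values_at_zero`) with denominators bounded below near `ρ = 0`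
   (`den_pos`, `denMu_pos`).  NOT formalised: the manifold-with-corners membership "`∈ r⁻²C^∞(M;S²𝒯)`" itself — the
   smoothness of the generators on `M` (H l.3752–3766) is the geometric input, recorded not proved.
4. Def. 3.9: `gRef_mul_gRefInv` (the printed covariant and dual reference metrics are inverse to each other),
   `gRef_sub_gMink` (`g_𝔪 − g̲ = (2𝔪/r)dt_*²` exactly: (3.21), second clause).
5. (§5, v3) Prop. 3.10 / (3.21) for the COVARIANT metrics, for ALL `(𝔪, a)`, BY INVERSION: `Gstar` / `Gstar_eq_pullback`
   (the correct covariant `(t_*)` form = the `(t̃_*)` covariant display transported by (3.13)); `gKerrFar_mul_gKerrInvFar`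
   (at large `r` the covariant and the `ϱ⁻²`-scaled dual forms ARE inverse 4×4 matrices); the exact inversion identity
   `E_eq_neg_mul_D_mul` : `E := g_{𝔪,a} − g_𝔪 = −g_{𝔪,a}·D·g_𝔪` (`D` of §3) — the content of "similarly"; the closed forms
   `E_tt`, `E_tr`, `E_rr`, `E_tφ`, `E_rφ`, `E_angular`, `E_offdiag_zero`; `E_generators` : `E` decomposes EXACTLY on the
   covariant smooth generators `dt_*²`, `2dt_*⊗_sdr`, `dr²`, `2dt_*⊗_s(aϖ)`, `2dr⊗_s(aϖ)`, `r²g̸`, `(aϖ)²` with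
   `ϖ := r sin²θ dφ = (x dy − y dx)/r` (`aϖ = a((x/r)dy − (y/r)dx)`, the covariant twin of the proof's `a∂_φ/r`;
   `a sin²θ dφ = ρ·aϖ`); and `E_rho_forms` : every one of the seven coefficients is `ρ²·Fc(ρ)` with `Fc` rational, regular at
   `ρ = 0` (`Fc_values_at_zero`; denominators `(1 + c2ρ²)`, `(1 − 2𝔪ρ + a²ρ²)` as in §3).  In particular the angular block
   of `g_{𝔪,a}` is `ϱ²g̸ + (1 + 2𝔪r/ϱ²)(a sin²θ dφ)²` (`E_angular`, `E_generators`), which is the smoothness of `g_{𝔪,a}` across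
   the axis `θ ∈ {0, π}` announced at H l.3723 ("only requires an argument near the poles").  NOT formalised, as in item 3:
   the memberships `dt_*, dr, aϖ ∈ C^∞(M;𝒯*)`, `r²g̸ ∈ C^∞(M;S²𝒯*)` themselves.
6. (§6, v3) (3.22) `EqKMetaExpr` as Euclidean identities for `𝔞 = (0,0,a)`, `x = r(sinθcosφ, sinθsinφ, cosθ)`, `r > 0`:
   `eqKMetaExpr_dphi` (`a·∂_φx = 𝔞 × x`, with `hasDerivAt_cart_phi` and the chain-rule form `eqKMetaExpr_dphi_chain`:
   `a∂_φ(f∘x) = df(𝔞 × x)`), `eqKMetaExpr_cos` (`a cosθ = 𝔞·x/|x|`), `eqKMetaExpr_sin2` (`a²sin²θ = |𝔞|² − (𝔞·x/|x|)²`);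
   the right-hand sides are polynomial in `𝔞` and `x/|x|`, whence the smooth dependence on `𝔞` near `𝔞 = 0` (H l.3763).

v3 (cell gen 21): the v1/v2 lint-debt (two tactic linters disabled locally on six theorems) is discharged — every entry
goal now carries its own tactic; §§5–6 are new; no statement of v2 was changed.
Second engines (standard library, exact rationals, random rational parameter points, every identity of this file):
`code/adep1-g20/kerr_dual_engineB_exact.py` (§§0–4) and `code/adep1-g21/kerr_cov_engineB_exact.py` (§§5–6) of the cell.
|a|-census (ADEP.md): every identity holds for all real `a`; `a` enters Prop. 3.10 only through the smooth quantities
`a cosθ`, `a²sin²θ`, `a∂_φ` — the "for all `b`, smoothly in `b`" leaf under Lemma 6.1(2) / Lemma 8.1(2) of the paper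
(`S − S̲ ∈ ρC^∞`, `□̂(0) − □̲̂(0) ∈ ρ³Diff_b`, eq. `EqWGOpDiff` H l.5900–5904; `L̂_b(0) − L̲̂(0) ∈ ρ³Diff_b`, eq. `EqWEOpKerrMink`
H l.7289–7293; their proofs, H l.5908 "One can prove (EqWGOpDiff) … by using (EqKMetDiff)" with (EqWGOpNabla) l.5909–5913, and
H l.7302 "The second part follows as before from (EqKMetDiff) and (EqWGOpNabla)", point to (3.21)) = HINTZ-PLAN R8's residual
input.
[cite: Hintz2026, §3.3: displays TeX l.3586-3592 and l.3620-3626; Lemma 3.6 `LemmaKMetTime` l.3629-3667 with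
(3.14) `EqKMetTimeNorm` l.3647 and (3.16) `EqKMetTime2` l.3662; (3.17) `EqKMetFinal` l.3668-3676; Def. 3.8
`DefKMetcM` l.3712-3722; Def. 3.9 `DefKMetRef` (3.19) l.3724-3734; Prop. 3.10 `PropKMetCpt` (3.20)-(3.22)
l.3735-3775, (3.21) `EqKMetDiff` l.3744-3749 ("similarly for the dual metrics" l.3749), (3.22) `EqKMetaExpr`
l.3753-3758 (claims under review; the algebra is reproduced here)]
-/

open Matrix

noncomputable section

namespace Literature.Geometry.Lorentzian.Hintz2026.KerrDualMetricForm

/-! ## 0. The Kerr functions, symmetric component matrices, and the chain-rule lemmas -/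

/-- `μ_{𝔪,a}(r) = r² − 2𝔪r + a²`. [cite: Hintz2026, TeX l.3589 (transcription)] -/
def mu (m a r : ℝ) : ℝ := r ^ 2 - 2 * m * r + a ^ 2

/-- `ϱ_a² = r² + a²cos²θ = r² + a²(1 − s2)`, `s2 = sin²θ`. [cite: Hintz2026, TeX l.3589 (transcription)] -/
def rhoSq (a r s2 : ℝ) : ℝ := r ^ 2 + a ^ 2 * (1 - s2)

/-- A symmetric `4×4` component matrix from its ten upper entries (order `00,01,02,03,11,12,13,22,23,33`). [folklore] -/
def Qsym (q00 q01 q02 q03 q11 q12 q13 q22 q23 q33 : ℝ) : Matrix (Fin 4) (Fin 4) ℝ :=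
  !![q00, q01, q02, q03; q01, q11, q12, q13; q02, q12, q22, q23; q03, q13, q23, q33]

section QsymAPI

variable (q00 q01 q02 q03 q11 q12 q13 q22 q23 q33 : ℝ)

/-- Entry `(0,0)` of `Qsym` is `q00`. [folklore] -/
@[simp] theorem Qsym00 : Qsym q00 q01 q02 q03 q11 q12 q13 q22 q23 q33 0 0 = q00 := rfl
/-- Entry `(0,1)` of `Qsym` is `q01`. [folklore] -/
@[simp] theorem Qsym01 : Qsym q00 q01 q02 q03 q11 q12 q13 q22 q23 q33 0 1 = q01 := rfl
/-- Entry `(0,2)` of `Qsym` is `q02`. [folklore] -/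
@[simp] theorem Qsym02 : Qsym q00 q01 q02 q03 q11 q12 q13 q22 q23 q33 0 2 = q02 := rfl
/-- Entry `(0,3)` of `Qsym` is `q03`. [folklore] -/
@[simp] theorem Qsym03 : Qsym q00 q01 q02 q03 q11 q12 q13 q22 q23 q33 0 3 = q03 := rfl
/-- Entry `(1,0)` of `Qsym` is `q01`. [folklore] -/
@[simp] theorem Qsym10 : Qsym q00 q01 q02 q03 q11 q12 q13 q22 q23 q33 1 0 = q01 := rfl
/-- Entry `(1,1)` of `Qsym` is `q11`. [folklore] -/
@[simp] theorem Qsym11 : Qsym q00 q01 q02 q03 q11 q12 q13 q22 q23 q33 1 1 = q11 := rfl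
/-- Entry `(1,2)` of `Qsym` is `q12`. [folklore] -/
@[simp] theorem Qsym12 : Qsym q00 q01 q02 q03 q11 q12 q13 q22 q23 q33 1 2 = q12 := rfl
/-- Entry `(1,3)` of `Qsym` is `q13`. [folklore] -/
@[simp] theorem Qsym13 : Qsym q00 q01 q02 q03 q11 q12 q13 q22 q23 q33 1 3 = q13 := rfl
/-- Entry `(2,0)` of `Qsym` is `q02`. [folklore] -/
@[simp] theorem Qsym20 : Qsym q00 q01 q02 q03 q11 q12 q13 q22 q23 q33 2 0 = q02 := rfl
/-- Entry `(2,1)` of `Qsym` is `q12`. [folklore] -/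
@[simp] theorem Qsym21 : Qsym q00 q01 q02 q03 q11 q12 q13 q22 q23 q33 2 1 = q12 := rfl
/-- Entry `(2,2)` of `Qsym` is `q22`. [folklore] -/
@[simp] theorem Qsym22 : Qsym q00 q01 q02 q03 q11 q12 q13 q22 q23 q33 2 2 = q22 := rfl
/-- Entry `(2,3)` of `Qsym` is `q23`. [folklore] -/
@[simp] theorem Qsym23 : Qsym q00 q01 q02 q03 q11 q12 q13 q22 q23 q33 2 3 = q23 := rfl
/-- Entry `(3,0)` of `Qsym` is `q03`. [folklore] -/
@[simp] theorem Qsym30 : Qsym q00 q01 q02 q03 q11 q12 q13 q22 q23 q33 3 0 = q03 := rfl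
/-- Entry `(3,1)` of `Qsym` is `q13`. [folklore] -/
@[simp] theorem Qsym31 : Qsym q00 q01 q02 q03 q11 q12 q13 q22 q23 q33 3 1 = q13 := rfl
/-- Entry `(3,2)` of `Qsym` is `q23`. [folklore] -/
@[simp] theorem Qsym32 : Qsym q00 q01 q02 q03 q11 q12 q13 q22 q23 q33 3 2 = q23 := rfl
/-- Entry `(3,3)` of `Qsym` is `q33`. [folklore] -/
@[simp] theorem Qsym33 : Qsym q00 q01 q02 q03 q11 q12 q13 q22 q23 q33 3 3 = q33 := rfl

/-- Two symmetric component matrices are equal when their ten entries are. [folklore] -/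
theorem Qsym_ext {p00 p01 p02 p03 p11 p12 p13 p22 p23 p33 : ℝ}
    (h00 : q00 = p00) (h01 : q01 = p01) (h02 : q02 = p02) (h03 : q03 = p03) (h11 : q11 = p11)
    (h12 : q12 = p12) (h13 : q13 = p13) (h22 : q22 = p22) (h23 : q23 = p23) (h33 : q33 = p33) :
    Qsym q00 q01 q02 q03 q11 q12 q13 q22 q23 q33 = Qsym p00 p01 p02 p03 p11 p12 p13 p22 p23 p33 := by
  subst h00 h01 h02 h03 h11 h12 h13 h22 h23 h33; rfl

variable (p00 p01 p02 p03 p11 p12 p13 p22 p23 p33 : ℝ)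

/-- Entrywise sum. [folklore] -/
theorem Qsym_add : Qsym q00 q01 q02 q03 q11 q12 q13 q22 q23 q33 + Qsym p00 p01 p02 p03 p11 p12 p13 p22 p23 p33
    = Qsym (q00 + p00) (q01 + p01) (q02 + p02) (q03 + p03) (q11 + p11) (q12 + p12) (q13 + p13) (q22 + p22)
      (q23 + p23) (q33 + p33) := by
  ext i j; fin_cases i <;> fin_cases j <;> rfl

/-- Entrywise difference. [folklore] -/
theorem Qsym_sub : Qsym q00 q01 q02 q03 q11 q12 q13 q22 q23 q33 - Qsym p00 p01 p02 p03 p11 p12 p13 p22 p23 p33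
    = Qsym (q00 - p00) (q01 - p01) (q02 - p02) (q03 - p03) (q11 - p11) (q12 - p12) (q13 - p13) (q22 - p22)
      (q23 - p23) (q33 - p33) := by
  ext i j; fin_cases i <;> fin_cases j <;> rfl

/-- Entrywise scalar multiple. [folklore] -/
theorem Qsym_smul (c : ℝ) : c • Qsym q00 q01 q02 q03 q11 q12 q13 q22 q23 q33
    = Qsym (c * q00) (c * q01) (c * q02) (c * q03) (c * q11) (c * q12) (c * q13) (c * q22) (c * q23) (c * q33) := by
  ext i j; fin_cases i <;> fin_cases j <;> rfl

/-- The zero matrix. [folklore] -/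
theorem Qsym_zero : Qsym 0 0 0 0 0 0 0 0 0 0 = 0 := by
  ext i j; fin_cases i <;> fin_cases j <;> rfl

end QsymAPI

/-- Frame change "`∂_r^{old} = ∂_r + T′∂_t + Φ′∂_φ`, other basis vectors unchanged": column `i` = new components of
the old `e_i`. [cite: Hintz2026, eq. (3.11) `EqKMetTstar` TeX l.3608-3612 and eq. (3.13) l.3633 (chain rule, folklore)] -/
def J1 (Tp Pp : ℝ) : Matrix (Fin 4) (Fin 4) ℝ := !![1, Tp, 0, 0; 0, 1, 0, 0; 0, 0, 1, 0; 0, Pp, 0, 1]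

/-- Contravariant chain rule, computed once for a generic symmetric matrix: `J Q Jᵀ`. [folklore] -/
theorem pullJ1 (Tp Pp q00 q01 q02 q03 q11 q12 q13 q22 q23 q33 : ℝ) :
    J1 Tp Pp * Qsym q00 q01 q02 q03 q11 q12 q13 q22 q23 q33 * (J1 Tp Pp)ᵀ =
      Qsym (q00 + 2 * Tp * q01 + Tp ^ 2 * q11) (q01 + Tp * q11) (q02 + Tp * q12)
        (q03 + Tp * q13 + Pp * (q01 + Tp * q11)) q11 q12 (q13 + Pp * q11) q22 (q23 + Pp * q12)
        (q33 + 2 * Pp * q13 + Pp ^ 2 * q11) := by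
  ext i j
  fin_cases i <;> fin_cases j <;> simp [J1, Qsym, Matrix.mul_apply, Fin.sum_univ_four] <;> ring

/-- Coframe change "`dt^{old} = dt − T′dr`, `dφ^{old} = dφ − Φ′dr`": row `i` = new components of the old `θ^i`.
[cite: Hintz2026, eq. (3.11) TeX l.3608-3612 (chain rule, folklore)] -/
def K1 (Tp Pp : ℝ) : Matrix (Fin 4) (Fin 4) ℝ := !![1, -Tp, 0, 0; 0, 1, 0, 0; 0, 0, 1, 0; 0, -Pp, 0, 1]

/-- Covariant chain rule, computed once for a generic symmetric matrix: `Kᵀ G K`. [folklore] -/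
theorem pullK1 (Tp Pp q00 q01 q02 q03 q11 q12 q13 q22 q23 q33 : ℝ) :
    (K1 Tp Pp)ᵀ * Qsym q00 q01 q02 q03 q11 q12 q13 q22 q23 q33 * K1 Tp Pp =
      Qsym q00 (q01 - Tp * q00 - Pp * q03) q02 q03
        (q11 - 2 * Tp * q01 - 2 * Pp * q13 + Tp ^ 2 * q00 + 2 * Tp * Pp * q03 + Pp ^ 2 * q33)
        (q12 - Tp * q02 - Pp * q23) (q13 - Tp * q03 - Pp * q33) q22 q23 q33 := by
  ext i j
  fin_cases i <;> fin_cases j <;> simp [K1, Qsym, Matrix.mul_apply, Fin.sum_univ_four] <;> ring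

/-! ## 1. Boyer–Lindquist → `(t̃_*, r, θ, φ)`: the printed displays are correct -/

/-- `ϱ²g⁻¹_{𝔪,a}` in BL coordinates, frame `(∂_𝔱, ∂_r, ∂_θ, ∂_ϕ)`.  Entries: `−μ⁻¹((r²+a²)∂_𝔱 + a∂_ϕ)²` gives
`tt: −(r²+a²)²/μ`, `tϕ: −a(r²+a²)/μ`, `ϕϕ: −a²/μ`; `μ∂_r²` gives `rr: μ`; `∂_θ²` gives `θθ: 1`;
`sin⁻²θ(∂_ϕ + a sin²θ∂_𝔱)²` gives `tt: a²sin²θ`, `tϕ: a`, `ϕϕ: sin⁻²θ`. [cite: Hintz2026, display TeX l.3592, v2 PDF p.71 (transcription)] -/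
def QBL (m a r s2 : ℝ) : Matrix (Fin 4) (Fin 4) ℝ :=
  Qsym (-(r ^ 2 + a ^ 2) ^ 2 / mu m a r + a ^ 2 * s2) 0 0 (-(a * (r ^ 2 + a ^ 2)) / mu m a r + a)
    (mu m a r) 0 0 1 0 (-a ^ 2 / mu m a r + 1 / s2)

/-- `T′_{𝔪,a}(r) = (χ_{𝓗⁺} − χ_∞)(r²+a²)/μ` (cut-off VALUES `χH`, `χI`). [cite: Hintz2026, eq. (3.11) TeX l.3609 (transcription)] -/
def Tprime (m a r χH χI : ℝ) : ℝ := (χH - χI) * (r ^ 2 + a ^ 2) / mu m a r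

/-- `Φ′_{𝔪,a}(r) = χ_{𝓗⁺} a/μ`. [cite: Hintz2026, eq. (3.11) TeX l.3610 (transcription)] -/
def Pprime (m a r χH : ℝ) : ℝ := χH * a / mu m a r

/-- The PRINTED dual display in `(t̃_*, r, θ, φ)` (H l.3624–3625).  Entries: `−((1−χH²)/μ)W⊗W` (`W = (r²+a²)∂_t + a∂_φ`)
gives `tt: −(1−χH²)(r²+a²)²/μ`, `tφ: −(1−χH²)a(r²+a²)/μ`, `φφ: −(1−χH²)a²/μ`; `μ∂_r²`: `rr: μ`; `∂_θ²`: `θθ: 1`;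
`sin⁻²θ(∂_φ + a sin²θ∂_t)²`: `tt: a²s2`, `tφ: a`, `φφ: 1/s2`; `2χH W⊗_s∂_r`: `tr: χH(r²+a²)`, `rφ: χH a`;
`−2χI(r²+a²)∂_t⊗_s∂_r`: `tr: −χI(r²+a²)`; `χI²((r²+a²)²/μ)∂_t²`: `tt: χI²(r²+a²)²/μ`.
[cite: Hintz2026, display TeX l.3624-3625, v2 PDF pp.71-72 (transcription)] -/
def Qtilde (m a r s2 χH χI : ℝ) : Matrix (Fin 4) (Fin 4) ℝ :=
  Qsym (-(1 - χH ^ 2) * (r ^ 2 + a ^ 2) ^ 2 / mu m a r + a ^ 2 * s2 + χI ^ 2 * (r ^ 2 + a ^ 2) ^ 2 / mu m a r)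
    (χH * (r ^ 2 + a ^ 2) - χI * (r ^ 2 + a ^ 2)) 0 (-(1 - χH ^ 2) * (a * (r ^ 2 + a ^ 2)) / mu m a r + a)
    (mu m a r) 0 (χH * a) 1 0 (-(1 - χH ^ 2) * a ^ 2 / mu m a r + 1 / s2)

/-- The cross term `−2χ_{𝓗⁺}χ_∞((r²+a²)/μ) W⊗_s∂_{t̃_*}` produced by the chain rule but absent from the display
(legitimately: `χ_{𝓗⁺}χ_∞ ≡ 0`): `tt: −2χHχI(r²+a²)²/μ`, `tφ: −χHχI a(r²+a²)/μ`. [cite: Hintz2026, TeX l.3602-3605 (disjoint supports) and l.3624-3625 (computed here)] -/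
def CrossHI (m a r χH χI : ℝ) : Matrix (Fin 4) (Fin 4) ℝ :=
  Qsym (-(2 * (χH * χI) * (r ^ 2 + a ^ 2) ^ 2) / mu m a r) 0 0 (-(χH * χI * (a * (r ^ 2 + a ^ 2))) / mu m a r)
    0 0 0 0 0 0

/-- **The `(t̃_*)` dual display is the pull-back of the BL dual metric** up to `CrossHI`, for all parameters.
[cite: Hintz2026, "We then compute" TeX l.3619-3626, v2 PDF pp.71-72 (reproduced)] -/
theorem tilde_dual_display (m a r s2 χH χI : ℝ) (hμ : mu m a r ≠ 0) :
    J1 (Tprime m a r χH χI) (Pprime m a r χH) * QBL m a r s2 * (J1 (Tprime m a r χH χI) (Pprime m a r χH))ᵀ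
      = Qtilde m a r s2 χH χI + CrossHI m a r χH χI := by
  rw [QBL, pullJ1, Qtilde, CrossHI, Qsym_add]
  simp only [Tprime, Pprime]
  refine Qsym_ext _ _ _ _ _ _ _ _ _ _ ?_ ?_ ?_ ?_ ?_ ?_ ?_ ?_ ?_ ?_
  · field_simp
    ring1
  · field_simp
    ring1
  · ring1
  · field_simp
    ring1
  · ring1
  · ring1
  · field_simp
    ring1
  · ring1
  · ring1
  · field_simp
    ring1

/-- Hence wherever `χ_{𝓗⁺}·χ_∞ = 0` (everywhere, H l.3602–3605) the printed display IS the Kerr dual metric.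
[cite: Hintz2026, display TeX l.3624-3625 (reproduced)] -/
theorem tilde_dual_display_of_disjoint (m a r s2 χH χI : ℝ) (hμ : mu m a r ≠ 0) (hχ : χH * χI = 0) :
    J1 (Tprime m a r χH χI) (Pprime m a r χH) * QBL m a r s2 * (J1 (Tprime m a r χH χI) (Pprime m a r χH))ᵀ
      = Qtilde m a r s2 χH χI := by
  have h0 : CrossHI m a r χH χI = 0 := by
    rw [CrossHI, hχ]
    simp only [mul_zero, zero_mul, neg_zero, zero_div]
    exact Qsym_zero
  rw [tilde_dual_display m a r s2 χH χI hμ, h0, add_zero]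

/-- BL covariant metric, coframe `(d𝔱, dr, dθ, dϕ)`.  Entries: `−(μ/ϱ²)A⊗A` (`A = d𝔱 − a sin²θdϕ`): `tt: −μ/ϱ²`,
`tϕ: μa s2/ϱ²`, `ϕϕ: −μa²s2²/ϱ²`; `(ϱ²/μ)dr²`; `ϱ²dθ²`; `(sin²θ/ϱ²)B⊗B` (`B = (r²+a²)dϕ − a d𝔱`): `tt: a²s2/ϱ²`,
`tϕ: −a s2(r²+a²)/ϱ²`, `ϕϕ: s2(r²+a²)²/ϱ²`. [cite: Hintz2026, display TeX l.3591, v2 PDF p.71 (transcription)] -/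
def GBL (m a r s2 : ℝ) : Matrix (Fin 4) (Fin 4) ℝ :=
  Qsym (-mu m a r / rhoSq a r s2 + a ^ 2 * s2 / rhoSq a r s2) 0 0
    (mu m a r * a * s2 / rhoSq a r s2 - a * s2 * (r ^ 2 + a ^ 2) / rhoSq a r s2)
    (rhoSq a r s2 / mu m a r) 0 0 (rhoSq a r s2) 0
    (-(mu m a r * a ^ 2 * s2 ^ 2) / rhoSq a r s2 + s2 * (r ^ 2 + a ^ 2) ^ 2 / rhoSq a r s2)

/-- The PRINTED covariant display in `(t̃_*, r, θ, φ)` (H l.3621–3623).  Entries: the `A⊗A`, `dθ²` and `B⊗B` terms as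
in `GBL`; `dr²`: `(1−χH²)ϱ²/μ − χI²(r²+a²)²(μ−a²s2)/(ϱ²μ²)`; `2χH A⊗_s dr`: `tr: χH`, `rφ: −χH a s2`;
`−2χI[X dt̃_* dr + Y dφ dr]`: `tr: −χI X`, `rφ: −χI Y`, `X = (r²+a²)(μ−a²s2)/(ϱ²μ)`, `Y = 2a𝔪r(r²+a²)s2/(ϱ²μ)`.
[cite: Hintz2026, display TeX l.3621-3623, v2 PDF p.71 (transcription)] -/
def Gtilde (m a r s2 χH χI : ℝ) : Matrix (Fin 4) (Fin 4) ℝ :=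
  Qsym (-mu m a r / rhoSq a r s2 + a ^ 2 * s2 / rhoSq a r s2)
    (χH - χI * ((r ^ 2 + a ^ 2) * (mu m a r - a ^ 2 * s2) / (rhoSq a r s2 * mu m a r))) 0
    (mu m a r * a * s2 / rhoSq a r s2 - a * s2 * (r ^ 2 + a ^ 2) / rhoSq a r s2)
    ((1 - χH ^ 2) * rhoSq a r s2 / mu m a r
      - χI ^ 2 * (r ^ 2 + a ^ 2) ^ 2 * (mu m a r - a ^ 2 * s2) / (rhoSq a r s2 * mu m a r ^ 2))
    0 (-(χH * a * s2) - χI * (2 * a * m * r * (r ^ 2 + a ^ 2) * s2 / (rhoSq a r s2 * mu m a r)))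
    (rhoSq a r s2) 0
    (-(mu m a r * a ^ 2 * s2 ^ 2) / rhoSq a r s2 + s2 * (r ^ 2 + a ^ 2) ^ 2 / rhoSq a r s2)

/-- **The `(t̃_*)` covariant display is the pull-back of the BL metric** up to the cross term `2χ_{𝓗⁺}χ_∞(r²+a²)/μ · dr²`
(which vanishes identically by the disjointness of the supports), for all parameters.
[cite: Hintz2026, display TeX l.3621-3623, v2 PDF p.71 (reproduced)] -/
theorem tilde_covariant_display (m a r s2 χH χI : ℝ) (hμ : mu m a r ≠ 0) (hρ : rhoSq a r s2 ≠ 0) :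
    (K1 (Tprime m a r χH χI) (Pprime m a r χH))ᵀ * GBL m a r s2 * K1 (Tprime m a r χH χI) (Pprime m a r χH)
      = Gtilde m a r s2 χH χI
        + Qsym 0 0 0 0 (2 * (χH * χI) * (r ^ 2 + a ^ 2) / mu m a r) 0 0 0 0 0 := by
  rw [GBL, pullK1, Gtilde, Qsym_add]
  simp only [Tprime, Pprime]
  refine Qsym_ext _ _ _ _ _ _ _ _ _ _ ?_ ?_ ?_ ?_ ?_ ?_ ?_ ?_ ?_ ?_
  · ring1
  · field_simp
    simp only [mu, rhoSq] at *
    ring1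
  · ring1
  · ring1
  · field_simp
    simp only [mu, rhoSq] at *
    ring1
  · ring1
  · field_simp
    simp only [mu, rhoSq] at *
    ring1
  · ring1
  · ring1
  · ring1

/-! ## 2. The shift (3.13) `t_* = t̃_* + T̃(r)` and the printed (3.17) `EqKMetFinal` — audit datum SRC-A39 -/

/-- The CORRECT `ϱ²g⁻¹_{𝔪,a}` in `(t_*, r, θ, φ)`: the `(t̃_*)` display transported by `∂_r ↦ ∂_r + T̃′∂_{t_*}`
(`τ = T̃′`), i.e. `J1 τ 0 · Qtilde · (J1 τ 0)ᵀ` (`Qstar_eq_pullback`).  Entries: `tt: Qtilde_tt + 2τ(χH−χI)(r²+a²) + τ²μ`,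
`tr: (χH−χI)(r²+a²) + τμ`, `tφ: Qtilde_tφ + τχH a`, the rest as in `Qtilde`.
[cite: Hintz2026, eq. (3.13) `EqKMetTime` TeX l.3633 applied to the display l.3624-3625 (computed here)] -/
def Qstar (m a r s2 χH χI τ : ℝ) : Matrix (Fin 4) (Fin 4) ℝ :=
  Qsym (-(1 - χH ^ 2) * (r ^ 2 + a ^ 2) ^ 2 / mu m a r + a ^ 2 * s2 + χI ^ 2 * (r ^ 2 + a ^ 2) ^ 2 / mu m a r
      + 2 * τ * (χH * (r ^ 2 + a ^ 2) - χI * (r ^ 2 + a ^ 2)) + τ ^ 2 * mu m a r)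
    (χH * (r ^ 2 + a ^ 2) - χI * (r ^ 2 + a ^ 2) + τ * mu m a r) 0
    (-(1 - χH ^ 2) * (a * (r ^ 2 + a ^ 2)) / mu m a r + a + τ * (χH * a))
    (mu m a r) 0 (χH * a) 1 0 (-(1 - χH ^ 2) * a ^ 2 / mu m a r + 1 / s2)

/-- `Qstar` IS the chain-rule transport of the `(t̃_*)` display under (3.13). [cite: Hintz2026, eq. (3.13) TeX l.3633 (computed here)] -/
theorem Qstar_eq_pullback (m a r s2 χH χI τ : ℝ) :
    J1 τ 0 * Qtilde m a r s2 χH χI * (J1 τ 0)ᵀ = Qstar m a r s2 χH χI τ := by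
  rw [Qtilde, pullJ1, Qstar]
  refine Qsym_ext _ _ _ _ _ _ _ _ _ _ ?_ ?_ ?_ ?_ ?_ ?_ ?_ ?_ ?_ ?_ <;> ring

/-- (3.17) `EqKMetFinal` AS PRINTED (H l.3672–3674).  Entries: `−((1−χH²)/μ)W⊗W`, `μ∂_r²` (BARE — no `T̃′`), `∂_θ²`,
`sin⁻²θ(∂_φ + a sin²θ∂_{t_*})²` as in `Qtilde`; `2χH W⊗_s(∂_r + τ∂_t)`: `tr: χH(r²+a²)`, `rφ: χH a`, `tt: 2τχH(r²+a²)`,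
`tφ: τχH a`; `−2χI(r²+a²)∂_t⊗_s(∂_r + τ∂_t)`: `tr: −χI(r²+a²)`, `tt: −2τχI(r²+a²)`; `χI²((r²+a²)²/μ)∂_t²`.
[cite: Hintz2026, eq. (3.17) `EqKMetFinal` TeX l.3668-3676, v2 PDF p.72 (transcription)] -/
def QstarPrinted (m a r s2 χH χI τ : ℝ) : Matrix (Fin 4) (Fin 4) ℝ :=
  Qsym (-(1 - χH ^ 2) * (r ^ 2 + a ^ 2) ^ 2 / mu m a r + a ^ 2 * s2 + 2 * τ * (χH * (r ^ 2 + a ^ 2))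
      - 2 * τ * (χI * (r ^ 2 + a ^ 2)) + χI ^ 2 * (r ^ 2 + a ^ 2) ^ 2 / mu m a r)
    (χH * (r ^ 2 + a ^ 2) - χI * (r ^ 2 + a ^ 2)) 0
    (-(1 - χH ^ 2) * (a * (r ^ 2 + a ^ 2)) / mu m a r + a + τ * (χH * a))
    (mu m a r) 0 (χH * a) 1 0 (-(1 - χH ^ 2) * a ^ 2 / mu m a r + 1 / s2)

/-- **SRC-A39.** Correct minus printed = `μ·(2T̃′ ∂_{t_*}⊗_s∂_r + T̃′² ∂²_{t_*})` (entries `tt: μτ²`, `tr = rt: μτ`),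
identically in all parameters: (3.17) should carry `μ(∂_r + T̃′∂_{t_*})²` in place of `μ∂_r²`.
[cite: Hintz2026, eq. (3.17) `EqKMetFinal` TeX l.3672 (audit datum SRC-A39, computed)] -/
theorem eqKMetFinal_defect (m a r s2 χH χI τ : ℝ) :
    Qstar m a r s2 χH χI τ - QstarPrinted m a r s2 χH χI τ
      = Qsym (mu m a r * τ ^ 2) (mu m a r * τ) 0 0 0 0 0 0 0 0 := by
  rw [Qstar, QstarPrinted, Qsym_sub]
  refine Qsym_ext _ _ _ _ _ _ _ _ _ _ ?_ ?_ ?_ ?_ ?_ ?_ ?_ ?_ ?_ ?_ <;> ring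

/-- The defect is non-zero as soon as `μ ≠ 0` and `T̃′ ≠ 0`; Lemma 3.6 takes `T̃′ = Cr⁻²` with `C > 0` for large `r`
(H l.3631), and a non-zero constant slope near the horizon (H l.3649). [cite: Hintz2026, eq. (3.17) TeX l.3672 and Lemma 3.6 l.3631 (audit datum SRC-A39)] -/
theorem eqKMetFinal_defect_ne_zero (m a r s2 χH χI τ : ℝ) (hμ : mu m a r ≠ 0) (hτ : τ ≠ 0) :
    Qstar m a r s2 χH χI τ ≠ QstarPrinted m a r s2 χH χI τ := by
  intro h
  have h01 := congrFun (congrFun (eqKMetFinal_defect m a r s2 χH χI τ) 0) 1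
  rw [h, sub_self, Matrix.zero_apply, Qsym01] at h01
  exact mul_ne_zero hμ hτ h01.symm

/-- (3.14) `EqKMetTimeNorm` (H l.3647; `r ≤ 3𝔪₀`: `χ_{𝓗⁺} = 1`, `χ_∞ = 0`): the `tt`-component of the CORRECT `(t_*)`
form is `2(r²+a²)T̃′ + μT̃′² + a²sin²θ` — with the `μT̃′²` that (3.17)-as-printed lacks.
[cite: Hintz2026, eq. (3.14) `EqKMetTimeNorm` TeX l.3645-3648, v2 PDF p.72 (reproduced from the correct form)] -/
theorem timeNorm_interior (m a r s2 τ : ℝ) :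
    Qstar m a r s2 1 0 τ 0 0 = 2 * (r ^ 2 + a ^ 2) * τ + mu m a r * τ ^ 2 + a ^ 2 * s2 := by
  rw [Qstar, Qsym00]; ring

/-- … whereas the PRINTED (3.17) would give `2(r²+a²)T̃′ + a²sin²θ` there (no `μT̃′²`): the paper's (3.14) is computed
with the correct form, not with (3.17) as printed. [cite: Hintz2026, eq. (3.17) vs (3.14), TeX l.3672 vs l.3647 (audit datum SRC-A39)] -/
theorem printed_timeNorm_interior (m a r s2 τ : ℝ) :
    QstarPrinted m a r s2 1 0 τ 0 0 = 2 * (r ^ 2 + a ^ 2) * τ + a ^ 2 * s2 := by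
  rw [QstarPrinted, Qsym00]; ring

/-- Far region (`r ≥ 5𝔪₀`: `χ_{𝓗⁺} = 0`, `χ_∞ = 1`), H l.3651: `ϱ²g⁻¹(dt_*,dt_*) = −2(r²+a²)T̃′ + μT̃′² + a²sin²θ`.
[cite: Hintz2026, proof of Lemma 3.6, display TeX l.3650-3652 (reproduced)] -/
theorem timeNorm_far (m a r s2 τ : ℝ) (hμ : mu m a r ≠ 0) :
    Qstar m a r s2 0 1 τ 0 0 = -2 * (r ^ 2 + a ^ 2) * τ + mu m a r * τ ^ 2 + a ^ 2 * s2 := by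
  rw [Qstar, Qsym00]
  field_simp
  ring

/-- (3.16) `EqKMetTime2` at `T̃′ = Cr⁻²` (with `a²r⁻⁴`, the cell's correction SRC-A15 of the printed `a r⁻⁴`):
`−2C(1 + a²r⁻²) + a²sin²θ + C²(r⁻² − 2𝔪r⁻³ + a²r⁻⁴)`. [cite: Hintz2026, eq. (3.16) `EqKMetTime2` TeX l.3660-3664, v2 PDF p.72 (reproduced)] -/
theorem timeNorm_far_C (m a r s2 C : ℝ) (hμ : mu m a r ≠ 0) (hr : r ≠ 0) :
    Qstar m a r s2 0 1 (C / r ^ 2) 0 0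
      = -2 * C * (1 + a ^ 2 * r⁻¹ ^ 2) + a ^ 2 * s2 + C ^ 2 * (r⁻¹ ^ 2 - 2 * m * r⁻¹ ^ 3 + a ^ 2 * r⁻¹ ^ 4) := by
  rw [timeNorm_far m a r s2 _ hμ, mu]
  field_simp
  ring1

/-- At `T̃′ = −(r²+a²)/μ` (`T̃ = −T_{𝔪,a}`, i.e. `t_* = 𝔱`, H l.3649) the interior norm is the Boyer–Lindquist value
`ϱ²g⁻¹(d𝔱,d𝔱) = (QBL)_{tt} = (−(r²+a²)² + μa²sin²θ)/μ` ("negative by the previous computation", H l.3641, 3649).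
[cite: Hintz2026, proof of Lemma 3.6, TeX l.3641 and l.3649 (reproduced)] -/
theorem timeNorm_at_BL (m a r s2 : ℝ) (hμ : mu m a r ≠ 0) :
    Qstar m a r s2 1 0 (-(r ^ 2 + a ^ 2) / mu m a r) 0 0 = QBL m a r s2 0 0 ∧
      QBL m a r s2 0 0 = (-(r ^ 2 + a ^ 2) ^ 2 + mu m a r * (a ^ 2 * s2)) / mu m a r := by
  rw [timeNorm_interior, QBL, Qsym00]
  constructor
  · field_simp
    ring1
  · field_simp

/-- H l.3641–3642: `μϱ²g⁻¹(d𝔱,d𝔱) = −((r²+a²)² − μa²sin²θ) ≤ −((r²+a²)² − μa²) = −(r⁴ + r²a² + 2a²𝔪r) < 0` for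
`r > 0`, `𝔪 ≥ 0`, `sin²θ ≤ 1`, wherever `μ ≥ 0` (the text: `r > r⁺`). [cite: Hintz2026, proof of Lemma 3.6, TeX l.3639-3643 (reproduced)] -/
theorem bl_time_norm_neg (m a r s2 : ℝ) (hr : 0 < r) (hm : 0 ≤ m) (hs1 : s2 ≤ 1) (hμ : 0 ≤ mu m a r) :
    -((r ^ 2 + a ^ 2) ^ 2 - mu m a r * (a ^ 2 * s2)) < 0 := by
  have h1 : mu m a r * (a ^ 2 * s2) ≤ mu m a r * a ^ 2 := by
    have : a ^ 2 * s2 ≤ a ^ 2 := by nlinarith [sq_nonneg a]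
    exact mul_le_mul_of_nonneg_left this hμ
  have h2 : (r ^ 2 + a ^ 2) ^ 2 - mu m a r * a ^ 2 = r ^ 4 + r ^ 2 * a ^ 2 + 2 * a ^ 2 * m * r := by
    simp only [mu]; ring
  have h3 : 0 < r ^ 4 + r ^ 2 * a ^ 2 + 2 * a ^ 2 * m * r := by positivity
  linarith

/-! ## 3. Prop. 3.10 / (3.21) `EqKMetDiff` for the dual metrics, at large `r` (`χ_{𝓗⁺} = 0`, `χ_∞ = 1`) -/

/-- Def. 3.9 (3.19): the reference Schwarzschild DUAL metric `g_𝔪⁻¹ = −2∂_{t_*}⊗_s∂_r + (1−2𝔪/r)∂_r² + r⁻²g̸⁻¹`,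
`g̸⁻¹ = ∂_θ² + sin⁻²θ∂_φ²`. [cite: Hintz2026, Def. 3.9 `DefKMetRef` eq. (3.19) TeX l.3727-3730, v2 PDF pp.73-74 (transcription)] -/
def gRefInv (m r s2 : ℝ) : Matrix (Fin 4) (Fin 4) ℝ :=
  Qsym 0 (-1) 0 0 (1 - 2 * m / r) 0 0 (1 / r ^ 2) 0 (1 / (r ^ 2 * s2))

/-- The Kerr dual metric at large `r`: `g⁻¹_{𝔪,a} = ϱ⁻²·Qstar(χ_{𝓗⁺} = 0, χ_∞ = 1, T̃′ = Cr⁻²)` (correct `(t_*)` form).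
[cite: Hintz2026, eq. (3.17) (corrected per SRC-A39) with Lemma 3.6's T̃′ = Cr⁻², TeX l.3631 (computed here)] -/
def gKerrInvFar (m a r s2 C : ℝ) : Matrix (Fin 4) (Fin 4) ℝ :=
  (1 / rhoSq a r s2) • Qstar m a r s2 0 1 (C / r ^ 2)

/-- `D := g⁻¹_{𝔪,a} − g_𝔪⁻¹` at large `r` — the object computed in the proof of Prop. 3.10.
[cite: Hintz2026, Prop. 3.10 proof TeX l.3769-3774 (computed here)] -/
def D (m a r s2 C : ℝ) : Matrix (Fin 4) (Fin 4) ℝ := gKerrInvFar m a r s2 C - gRefInv m r s2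

/-- `D` as one symmetric component matrix (entries read off `Qstar` at `χH = 0`, `χI = 1`, `τ = C/r²`).
[cite: Hintz2026, Prop. 3.10 proof TeX l.3769-3774 (computed here)] -/
theorem D_eq (m a r s2 C : ℝ) : D m a r s2 C =
    Qsym (1 / rhoSq a r s2 * (-(1 - 0 ^ 2) * (r ^ 2 + a ^ 2) ^ 2 / mu m a r + a ^ 2 * s2
            + 1 ^ 2 * (r ^ 2 + a ^ 2) ^ 2 / mu m a r
            + 2 * (C / r ^ 2) * (0 * (r ^ 2 + a ^ 2) - 1 * (r ^ 2 + a ^ 2)) + (C / r ^ 2) ^ 2 * mu m a r) - 0)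
      (1 / rhoSq a r s2 * (0 * (r ^ 2 + a ^ 2) - 1 * (r ^ 2 + a ^ 2) + C / r ^ 2 * mu m a r) - -1)
      (1 / rhoSq a r s2 * 0 - 0)
      (1 / rhoSq a r s2 * (-(1 - 0 ^ 2) * (a * (r ^ 2 + a ^ 2)) / mu m a r + a + C / r ^ 2 * (0 * a)) - 0)
      (1 / rhoSq a r s2 * mu m a r - (1 - 2 * m / r)) (1 / rhoSq a r s2 * 0 - 0) (1 / rhoSq a r s2 * (0 * a) - 0)
      (1 / rhoSq a r s2 * 1 - 1 / r ^ 2) (1 / rhoSq a r s2 * 0 - 0)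
      (1 / rhoSq a r s2 * (-(1 - 0 ^ 2) * a ^ 2 / mu m a r + 1 / s2) - 1 / (r ^ 2 * s2)) := by
  rw [D, gKerrInvFar, gRefInv, Qstar, Qsym_smul, Qsym_sub]

section Coefficients

variable (m a r s2 C : ℝ)

/-- `D^{t_*t_*} = (a²sin²θ − 2(r²+a²)T̃′ + μT̃′²)/ϱ²`, `T̃′ = Cr⁻²` — numerator `O(1)`, denominator `ϱ² ∼ r²`: the
`∂²_{t_*}`-coefficient is `O(r⁻²)` ("the `∂²_{t_*}`-terms cancel as well", H l.3774 — the `O(r²)·∂²_{t_*}` terms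
`∓(r²+a²)²/μ` of the display cancel EXACTLY, leaving these, `T̃′`-terms included).
[cite: Hintz2026, Prop. 3.10 proof TeX l.3769-3774 (computed here)] -/
theorem D_tt : D m a r s2 C 0 0
    = (a ^ 2 * s2 - 2 * (r ^ 2 + a ^ 2) * (C / r ^ 2) + mu m a r * (C / r ^ 2) ^ 2) / rhoSq a r s2 := by
  rw [D_eq, Qsym00]; ring

/-- `D^{t_*r} = D^{rt_*} = (−a²sin²θ + μT̃′)/ϱ²` (uses `ϱ² − r² − a² = −a²sin²θ`) — `O(r⁻²)`.
[cite: Hintz2026, Prop. 3.10 proof TeX l.3769-3774 (computed here)] -/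
theorem D_tr (hρ : rhoSq a r s2 ≠ 0) :
    D m a r s2 C 0 1 = (-(a ^ 2 * s2) + mu m a r * (C / r ^ 2)) / rhoSq a r s2 ∧
      D m a r s2 C 1 0 = D m a r s2 C 0 1 := by
  refine ⟨?_, by rw [D_eq, Qsym01, Qsym10]⟩
  rw [D_eq, Qsym01]
  field_simp
  simp only [mu, rhoSq] at *
  ring

/-- `D^{rr} = μ/ϱ² − (1 − 2𝔪/r) = a²(r sin²θ + 2𝔪cos²θ)/(rϱ²)` — `O(r⁻²)`. [cite: Hintz2026, Prop. 3.10 proof TeX l.3769-3774 (computed here)] -/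
theorem D_rr (hr : r ≠ 0) (hρ : rhoSq a r s2 ≠ 0) :
    D m a r s2 C 1 1 = a ^ 2 * (r * s2 + 2 * m * (1 - s2)) / (r * rhoSq a r s2) := by
  rw [D_eq, Qsym11]
  field_simp
  simp only [mu, rhoSq] at *
  ring

/-- `D^{t_*φ} = D^{φt_*} = −2𝔪ar/(μϱ²) = (a/r)·(−2𝔪r²/(μϱ²))`: the `∂_{t_*}⊗_s∂_φ`-part of `D` is `O(r⁻²) · 2∂_{t_*}⊗_s(a∂_φ/r)`
with the smooth generator `a∂_φ/r` ("the `∂_{t_*}⊗_s a∂_φ`-terms cancel modulo `r⁻²C^∞`", H l.3774: the `O(1)` terms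
`a − a(r²+a²)/μ` combine to `−2𝔪ar/μ = O(r⁻¹)·a`); no division by `a` — `a = 0` included.
[cite: Hintz2026, Prop. 3.10 proof TeX l.3774 (computed here)] -/
theorem D_tφ (hμ : mu m a r ≠ 0) (hρ : rhoSq a r s2 ≠ 0) :
    D m a r s2 C 0 3 = -(2 * m * a * r) / (mu m a r * rhoSq a r s2) ∧ D m a r s2 C 3 0 = D m a r s2 C 0 3 := by
  refine ⟨?_, by rw [D_eq, Qsym03, Qsym30]⟩
  rw [D_eq, Qsym03]
  field_simp
  simp only [mu, rhoSq] at *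
  ring

/-- Angular part: `D^{θθ} = ϱ⁻² − r⁻² = −a²cos²θ/(r²ϱ²)` and `D^{φφ} = −a²cos²θ/(sin²θ r²ϱ²) − a²/(μϱ²)`, i.e.
`D^{ang} = (−a²cos²θ/ϱ²)·r⁻²(∂_θ² + sin⁻²θ∂_φ²) + (−r²/(μϱ²))·(a∂_φ/r)²` — both coefficients `O(r⁻²)`.
[cite: Hintz2026, Prop. 3.10 proof TeX l.3769-3774 (computed here)] -/
theorem D_angular (hr : r ≠ 0) (hs : s2 ≠ 0) (hμ : mu m a r ≠ 0) (hρ : rhoSq a r s2 ≠ 0) :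
    D m a r s2 C 2 2 = -(a ^ 2 * (1 - s2)) / (r ^ 2 * rhoSq a r s2) ∧
      D m a r s2 C 3 3 = -(a ^ 2 * (1 - s2)) / (s2 * r ^ 2 * rhoSq a r s2) - a ^ 2 / (mu m a r * rhoSq a r s2) := by
  constructor
  · rw [D_eq, Qsym22]
    field_simp
    simp only [mu, rhoSq] at *
    ring
  · rw [D_eq, Qsym33]
    field_simp
    simp only [mu, rhoSq] at *
    ring

/-- The remaining components of `D` vanish identically (`tθ`, `rθ`, `rφ`, `θφ` and transposes).
[cite: Hintz2026, Prop. 3.10 proof TeX l.3769-3774 (computed here)] -/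
theorem D_offdiag_zero :
    D m a r s2 C 0 2 = 0 ∧ D m a r s2 C 2 0 = 0 ∧ D m a r s2 C 1 2 = 0 ∧ D m a r s2 C 2 1 = 0 ∧
      D m a r s2 C 1 3 = 0 ∧ D m a r s2 C 3 1 = 0 ∧ D m a r s2 C 2 3 = 0 ∧ D m a r s2 C 3 2 = 0 := by
  rw [D_eq]
  simp only [Qsym02, Qsym20, Qsym12, Qsym21, Qsym13, Qsym31, Qsym23, Qsym32]
  norm_num

/-! ### The `ρ = r⁻¹` dictionary: every closed form above is `ρ² ×` (rational function regular at `ρ = 0`) -/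

/-- `μ = r²(1 − 2𝔪ρ + a²ρ²)` when `rρ = 1`. [folklore] -/
theorem mu_rho (ρ : ℝ) (h : r * ρ = 1) : mu m a r = r ^ 2 * (1 - 2 * m * ρ + a ^ 2 * ρ ^ 2) := by
  rw [mu]; linear_combination (2 * m * r - a ^ 2 * (r * ρ + 1)) * h

/-- `ϱ² = r²(1 + c2ρ²)`, `c2 = a²cos²θ = a²(1 − s2)`, when `rρ = 1`. [folklore] -/
theorem rhoSq_rho (ρ : ℝ) (h : r * ρ = 1) : rhoSq a r s2 = r ^ 2 * (1 + a ^ 2 * (1 - s2) * ρ ^ 2) := by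
  rw [rhoSq]; linear_combination (-(a ^ 2 * (1 - s2)) * (r * ρ + 1)) * h

/-- Coefficient functions of `ρ = r⁻¹` (`c2 = a²cos²θ`): on `∂²_{t_*}`,
`F_tt(ρ) = (a² − c2 − 2C(1 + a²ρ²) + C²ρ²(1 − 2𝔪ρ + a²ρ²))/(1 + c2ρ²)`. [cite: Hintz2026, Prop. 3.10 proof (computed here)] -/
def F_tt (m a c2 C ρ : ℝ) : ℝ :=
  (a ^ 2 - c2 - 2 * C * (1 + a ^ 2 * ρ ^ 2) + C ^ 2 * ρ ^ 2 * (1 - 2 * m * ρ + a ^ 2 * ρ ^ 2)) / (1 + c2 * ρ ^ 2)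
/-- On `2∂_{t_*}⊗_s∂_r`: `F_tr(ρ) = (−(a² − c2) + C(1 − 2𝔪ρ + a²ρ²))/(1 + c2ρ²)`. [cite: Hintz2026, Prop. 3.10 proof (computed here)] -/
def F_tr (m a c2 C ρ : ℝ) : ℝ := (-(a ^ 2 - c2) + C * (1 - 2 * m * ρ + a ^ 2 * ρ ^ 2)) / (1 + c2 * ρ ^ 2)
/-- On `∂_r²`: `F_rr(ρ) = (a² − c2(1 − 2𝔪ρ))/(1 + c2ρ²)`. [cite: Hintz2026, Prop. 3.10 proof (computed here)] -/
def F_rr (m a c2 ρ : ℝ) : ℝ := (a ^ 2 - c2 * (1 - 2 * m * ρ)) / (1 + c2 * ρ ^ 2)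
/-- On `2∂_{t_*}⊗_s(a∂_φ/r)`: `F_tφ(ρ) = −2𝔪/((1 − 2𝔪ρ + a²ρ²)(1 + c2ρ²))`. [cite: Hintz2026, Prop. 3.10 proof TeX l.3774 (computed here)] -/
def F_tφ (m a c2 ρ : ℝ) : ℝ := -(2 * m) / ((1 - 2 * m * ρ + a ^ 2 * ρ ^ 2) * (1 + c2 * ρ ^ 2))
/-- On `(a∂_φ/r)²`: `F_φφ(ρ) = −1/((1 − 2𝔪ρ + a²ρ²)(1 + c2ρ²))`. [cite: Hintz2026, Prop. 3.10 proof (computed here)] -/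
def F_φφ (m a c2 ρ : ℝ) : ℝ := -1 / ((1 - 2 * m * ρ + a ^ 2 * ρ ^ 2) * (1 + c2 * ρ ^ 2))
/-- On `r⁻²(∂_θ² + sin⁻²θ∂_φ²)`: `F_Ω(ρ) = −c2/(1 + c2ρ²)`. [cite: Hintz2026, Prop. 3.10 proof (computed here)] -/
def F_Ω (c2 ρ : ℝ) : ℝ := -c2 / (1 + c2 * ρ ^ 2)

/-- The `F`'s at `ρ = 0` (`r = ∞`) are finite numbers: every coefficient of `D` is `r⁻² ×` a function with a Taylor
expansion in `ρ` at `ρ = 0`. [cite: Hintz2026, Prop. 3.10 eq. (3.21) `EqKMetDiff` TeX l.3745-3748 (the r⁻² claim; computed here)] -/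
theorem F_values_at_zero (m a c2 C : ℝ) :
    F_tt m a c2 C 0 = a ^ 2 - c2 - 2 * C ∧ F_tr m a c2 C 0 = -(a ^ 2 - c2) + C ∧ F_rr m a c2 0 = a ^ 2 - c2 ∧
      F_tφ m a c2 0 = -(2 * m) ∧ F_φφ m a c2 0 = -1 ∧ F_Ω c2 0 = -c2 := by
  simp [F_tt, F_tr, F_rr, F_tφ, F_φφ, F_Ω]

/-- The denominator `1 + c2ρ²` is `≥ 1 > 0` (`c2 = a²cos²θ ≥ 0`). [folklore] -/
theorem den_pos (c2 ρ : ℝ) (hc : 0 ≤ c2) : 0 < 1 + c2 * ρ ^ 2 := by positivity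

/-- The denominator `1 − 2𝔪ρ + a²ρ² = μ/r²` is `≥ ½` for `ρ ≤ 1/(4𝔪)`, `𝔪 > 0` (i.e. `r ≥ 4𝔪`). [folklore] -/
theorem denMu_pos (m a ρ : ℝ) (hm : 0 < m) (h1 : ρ ≤ 1 / (4 * m)) :
    1 / 2 ≤ 1 - 2 * m * ρ + a ^ 2 * ρ ^ 2 := by
  have h2 : 2 * m * ρ ≤ 1 / 2 := by
    have := mul_le_mul_of_nonneg_left h1 (by linarith : (0 : ℝ) ≤ 2 * m)
    calc 2 * m * ρ ≤ 2 * m * (1 / (4 * m)) := this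
      _ = 1 / 2 := by field_simp; ring
  nlinarith [sq_nonneg (a * ρ)]

/-- The closed forms of `D_tt` … `D_angular` ARE `ρ²·F(ρ)` at `ρ = r⁻¹` (`r > 0`, `μ ≠ 0`, `ϱ² ≠ 0`, `sin²θ ≠ 0`):
`D^{tt} = ρ²F_tt(ρ)`, `D^{tr} = ρ²F_tr(ρ)`, `D^{rr} = ρ²F_rr(ρ)`, `D^{tφ} = (aρ)·ρ²F_tφ(ρ)`,
`D^{θθ} = ρ²·ρ²F_Ω(ρ)`, `D^{φφ} = (ρ²/sin²θ)·ρ²F_Ω(ρ) + (aρ)²·ρ²F_φφ(ρ)`.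
[cite: Hintz2026, Prop. 3.10 eq. (3.21) (the r⁻² structure; computed here)] -/
theorem D_rho_forms (ρ : ℝ) (hρ0 : 0 < ρ) (h : r * ρ = 1) (hμ : mu m a r ≠ 0) (hϱ : rhoSq a r s2 ≠ 0)
    (hs : s2 ≠ 0) :
    (a ^ 2 * s2 - 2 * (r ^ 2 + a ^ 2) * (C / r ^ 2) + mu m a r * (C / r ^ 2) ^ 2) / rhoSq a r s2
        = ρ ^ 2 * F_tt m a (a ^ 2 * (1 - s2)) C ρ ∧
      (-(a ^ 2 * s2) + mu m a r * (C / r ^ 2)) / rhoSq a r s2 = ρ ^ 2 * F_tr m a (a ^ 2 * (1 - s2)) C ρ ∧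
      a ^ 2 * (r * s2 + 2 * m * (1 - s2)) / (r * rhoSq a r s2) = ρ ^ 2 * F_rr m a (a ^ 2 * (1 - s2)) ρ ∧
      -(2 * m * a * r) / (mu m a r * rhoSq a r s2) = (a * ρ) * (ρ ^ 2 * F_tφ m a (a ^ 2 * (1 - s2)) ρ) ∧
      -(a ^ 2 * (1 - s2)) / (r ^ 2 * rhoSq a r s2) = ρ ^ 2 * (ρ ^ 2 * F_Ω (a ^ 2 * (1 - s2)) ρ) ∧
      -(a ^ 2 * (1 - s2)) / (s2 * r ^ 2 * rhoSq a r s2) - a ^ 2 / (mu m a r * rhoSq a r s2)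
        = ρ ^ 2 / s2 * (ρ ^ 2 * F_Ω (a ^ 2 * (1 - s2)) ρ) + (a * ρ) ^ 2 * (ρ ^ 2 * F_φφ m a (a ^ 2 * (1 - s2)) ρ) := by
  have _hρ : ρ ≠ 0 := hρ0.ne'
  have _h1 : 1 + a ^ 2 * (1 - s2) * ρ ^ 2 ≠ 0 := by
    intro hz; apply hϱ; rw [rhoSq_rho a r s2 ρ h, hz, mul_zero]
  have _h2 : 1 - 2 * m * ρ + a ^ 2 * ρ ^ 2 ≠ 0 := by
    intro hz; apply hμ; rw [mu_rho m a r ρ h, hz, mul_zero]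
  have hr : r = ρ⁻¹ := eq_inv_of_mul_eq_one_left h
  subst hr
  simp only [mu, rhoSq, F_tt, F_tr, F_rr, F_tφ, F_φφ, F_Ω] at *
  refine ⟨?_, ?_, ?_, ?_, ?_, ?_⟩
  · field_simp
    ring1
  · field_simp
    ring1
  · field_simp
    ring1
  · field_simp
  · field_simp
  · field_simp
    ring1

/-- The `T̃′`-terms missing from the printed (3.17) are themselves of class `r⁻²C^∞` at large `r`: divided by `ϱ²`,
`μ·2T̃′/ϱ² = 2Cμ/(r²ϱ²)` and `μT̃′²/ϱ² = C²μ/(r⁴ϱ²)`; at `ρ = r⁻¹`: `= ρ²·2C(1−2𝔪ρ+a²ρ²)/(1+c2ρ²)` and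
`= ρ²·C²ρ²(1−2𝔪ρ+a²ρ²)/(1+c2ρ²)` — which is why the slip SRC-A39 does not touch Prop. 3.10.
[cite: Hintz2026, Prop. 3.10 proof TeX l.3769 ("dropping terms in r⁻²C^∞"; computed here)] -/
theorem defect_far_coefficients (ρ : ℝ) (hρ0 : 0 < ρ) (h : r * ρ = 1) (hϱ : rhoSq a r s2 ≠ 0) :
    mu m a r * (2 * (C / r ^ 2)) / rhoSq a r s2
        = ρ ^ 2 * (2 * C * (1 - 2 * m * ρ + a ^ 2 * ρ ^ 2) / (1 + a ^ 2 * (1 - s2) * ρ ^ 2)) ∧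
      mu m a r * (C / r ^ 2) ^ 2 / rhoSq a r s2
        = ρ ^ 2 * (C ^ 2 * ρ ^ 2 * (1 - 2 * m * ρ + a ^ 2 * ρ ^ 2) / (1 + a ^ 2 * (1 - s2) * ρ ^ 2)) := by
  have _hρ : ρ ≠ 0 := hρ0.ne'
  have _h1 : 1 + a ^ 2 * (1 - s2) * ρ ^ 2 ≠ 0 := by
    intro hz; apply hϱ; rw [rhoSq_rho a r s2 ρ h, hz, mul_zero]
  have hr : r = ρ⁻¹ := eq_inv_of_mul_eq_one_left h
  subst hr
  simp only [mu, rhoSq] at *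
  refine ⟨?_, ?_⟩
  · field_simp
  · field_simp

end Coefficients

/-! ## 4. Def. 3.9: the reference metrics -/

/-- Def. 3.9 (3.19), covariant: `g_𝔪 = −(1−2𝔪/r)dt_*² − 2dt_*dr + r²(dθ² + sin²θ dφ²)`, coframe `(dt_*, dr, dθ, dφ)`;
`g̲ = g_0`. [cite: Hintz2026, Def. 3.9 `DefKMetRef` eq. (3.19) TeX l.3727-3731 (transcription)] -/
def gRef (m r s2 : ℝ) : Matrix (Fin 4) (Fin 4) ℝ :=
  Qsym (-(1 - 2 * m / r)) (-1) 0 0 0 0 0 (r ^ 2) 0 (r ^ 2 * s2)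

/-- The printed pair `(g_𝔪, g_𝔪⁻¹)` of (3.19) IS a metric and its inverse (`r ≠ 0`, `sinθ ≠ 0`).
[cite: Hintz2026, Def. 3.9 eq. (3.19) TeX l.3727-3730 (consistency check, computed here)] -/
theorem gRef_mul_gRefInv (m r s2 : ℝ) (hr : r ≠ 0) (hs : s2 ≠ 0) : gRef m r s2 * gRefInv m r s2 = 1 := by
  ext i j
  fin_cases i <;> fin_cases j <;>
    simp [gRef, gRefInv, Qsym, Matrix.mul_apply, Fin.sum_univ_four] <;> field_simp

/-- (3.21), second clause: `g_𝔪 − g̲ = (2𝔪/r) dt_*²`, exactly (`g̲ = g_0`, Def. 3.9). [cite: Hintz2026, Prop. 3.10 eq. (3.21) `EqKMetDiff` TeX l.3745-3747 (reproduced)] -/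
theorem gRef_sub_gMink (m r s2 : ℝ) : gRef m r s2 - gRef 0 r s2 = Qsym (2 * m / r) 0 0 0 0 0 0 0 0 0 := by
  rw [gRef, gRef, Qsym_sub]
  refine Qsym_ext _ _ _ _ _ _ _ _ _ _ ?_ ?_ ?_ ?_ ?_ ?_ ?_ ?_ ?_ ?_ <;> ring

/-! ## 5. Prop. 3.10 / (3.21) `EqKMetDiff` for the COVARIANT metrics — by inversion (v3)

Prop. 3.10 STATES (3.21) for the covariant metrics `g_{𝔪,𝔞} − g_𝔪 ∈ r⁻²C^∞(M;S²𝒯*)` and adds "similarly for the dual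
metrics" (H l.3749); its printed proof (H l.3751–3775) treats the DUAL metric only.  The covariant statement then
follows by inversion: with both `g_{𝔪,a}, g_𝔪 ∈ C^∞(M;S²𝒯*)` non-degenerate, `g_{𝔪,a} − g_𝔪 = −g_{𝔪,a}·(g_{𝔪,a}⁻¹ − g_𝔪⁻¹)·g_𝔪`.
This section makes that step explicit on the printed coordinate forms (all real `𝔪, a`; large `r`: `χ_{𝓗⁺} = 0`,
`χ_∞ = 1`, `T̃′ = Cr⁻²`), computes `E := g_{𝔪,a} − g_𝔪` in closed form, and exhibits its `ρ = r⁻¹` structure on covariant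
smooth generators, exactly parallel to §3. -/

/-- The CORRECT covariant `g_{𝔪,a}` in `(t_*, r, θ, φ)`: the `(t̃_*)` covariant display `Gtilde` transported by (3.13),
`dt̃_* = dt_* − T̃′dr` (`τ = T̃′`), i.e. `(K1 τ 0)ᵀ · Gtilde · K1 τ 0` (`Gstar_eq_pullback`).  Entries: `tr: G̃_tr − τG̃_tt`,
`rr: G̃_rr − 2τG̃_tr + τ²G̃_tt`, `rφ: G̃_rφ − τG̃_tφ`, all other entries those of `Gtilde`.
[cite: Hintz2026, eq. (3.13) `EqKMetTime` TeX l.3633 applied to the display l.3621-3623 (computed here)] -/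
def Gstar (m a r s2 χH χI τ : ℝ) : Matrix (Fin 4) (Fin 4) ℝ :=
  Qsym (-mu m a r / rhoSq a r s2 + a ^ 2 * s2 / rhoSq a r s2)
    (χH - χI * ((r ^ 2 + a ^ 2) * (mu m a r - a ^ 2 * s2) / (rhoSq a r s2 * mu m a r))
      - τ * (-mu m a r / rhoSq a r s2 + a ^ 2 * s2 / rhoSq a r s2))
    0 (mu m a r * a * s2 / rhoSq a r s2 - a * s2 * (r ^ 2 + a ^ 2) / rhoSq a r s2)
    ((1 - χH ^ 2) * rhoSq a r s2 / mu m a r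
        - χI ^ 2 * (r ^ 2 + a ^ 2) ^ 2 * (mu m a r - a ^ 2 * s2) / (rhoSq a r s2 * mu m a r ^ 2)
      - 2 * τ * (χH - χI * ((r ^ 2 + a ^ 2) * (mu m a r - a ^ 2 * s2) / (rhoSq a r s2 * mu m a r)))
      + τ ^ 2 * (-mu m a r / rhoSq a r s2 + a ^ 2 * s2 / rhoSq a r s2))
    0
    (-(χH * a * s2) - χI * (2 * a * m * r * (r ^ 2 + a ^ 2) * s2 / (rhoSq a r s2 * mu m a r))
      - τ * (mu m a r * a * s2 / rhoSq a r s2 - a * s2 * (r ^ 2 + a ^ 2) / rhoSq a r s2))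
    (rhoSq a r s2) 0 (-(mu m a r * a ^ 2 * s2 ^ 2) / rhoSq a r s2 + s2 * (r ^ 2 + a ^ 2) ^ 2 / rhoSq a r s2)

/-- `Gstar` IS the chain-rule transport of the `(t̃_*)` covariant display under (3.13). [cite: Hintz2026, eq. (3.13) `EqKMetTime` TeX l.3633 (computed here)] -/
theorem Gstar_eq_pullback (m a r s2 χH χI τ : ℝ) :
    (K1 τ 0)ᵀ * Gtilde m a r s2 χH χI * K1 τ 0 = Gstar m a r s2 χH χI τ := by
  rw [Gtilde, pullK1, Gstar]
  refine Qsym_ext _ _ _ _ _ _ _ _ _ _ ?_ ?_ ?_ ?_ ?_ ?_ ?_ ?_ ?_ ?_ <;> ring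

/-- The Kerr COVARIANT metric at large `r` (`χ_{𝓗⁺} = 0`, `χ_∞ = 1`, `T̃′ = Cr⁻²`) in `(t_*, r, θ, φ)` — Def. 3.8's
"the metric `g_{𝔪,a}` in the coordinates `t_*`, `r`, `θ`, `φ`", correct `(t_*)` form.
[cite: Hintz2026, Def. 3.8 `DefKMetcM` TeX l.3712-3722 with Lemma 3.6's T̃′ = Cr⁻², l.3631 (computed here)] -/
def gKerrFar (m a r s2 C : ℝ) : Matrix (Fin 4) (Fin 4) ℝ := Gstar m a r s2 0 1 (C / r ^ 2)

/-- Consistency of the two large-`r` forms: the covariant `gKerrFar` and the dual `gKerrInvFar` (§3: `ϱ⁻²·` the correct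
`(t_*)` dual form) ARE inverse to each other, `g_{𝔪,a}·g_{𝔪,a}⁻¹ = 1`, for all `(𝔪, a)` wherever `r, sin θ, μ, ϱ² ≠ 0`.
[cite: Hintz2026, displays TeX l.3621-3626 under (3.13) (consistency of the printed covariant and dual displays, computed here)] -/
theorem gKerrFar_mul_gKerrInvFar (m a r s2 C : ℝ) (hr : r ≠ 0) (hs : s2 ≠ 0) (hμ : mu m a r ≠ 0)
    (hρ : rhoSq a r s2 ≠ 0) : gKerrFar m a r s2 C * gKerrInvFar m a r s2 C = 1 := by
  ext i j
  fin_cases i <;> fin_cases j <;>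
    simp [gKerrFar, gKerrInvFar, Gstar, Qstar, Qsym, Matrix.mul_apply, Fin.sum_univ_four] <;>
    field_simp <;> (simp only [mu, rhoSq]; ring)

/-- Def. 3.9 (3.19), the other order: `g_𝔪⁻¹·g_𝔪 = 1` (`r ≠ 0`, `sin θ ≠ 0`). [cite: Hintz2026, Def. 3.9 eq. (3.19) TeX l.3727-3730 (consistency check, computed here)] -/
theorem gRefInv_mul_gRef (m r s2 : ℝ) (hr : r ≠ 0) (hs : s2 ≠ 0) : gRefInv m r s2 * gRef m r s2 = 1 :=
  mul_eq_one_comm.mp (gRef_mul_gRefInv m r s2 hr hs)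

/-- `E := g_{𝔪,a} − g_𝔪` (COVARIANT) at large `r` — the object of (3.21), first clause.
[cite: Hintz2026, Prop. 3.10 eq. (3.21) `EqKMetDiff` TeX l.3744-3747 (computed here)] -/
def E (m a r s2 C : ℝ) : Matrix (Fin 4) (Fin 4) ℝ := gKerrFar m a r s2 C - gRef m r s2

/-- **(3.21) for the covariant metrics, BY INVERSION**: `g_{𝔪,a} − g_𝔪 = −g_{𝔪,a}·(g_{𝔪,a}⁻¹ − g_𝔪⁻¹)·g_𝔪`, i.e.
`E = −g_{𝔪,a}·D·g_𝔪` with the `D` of §3 — exactly, for all `(𝔪, a)` (wherever `r, sin θ, μ, ϱ² ≠ 0`).  With `D ∈ r⁻²C^∞(M;S²𝒯)`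
(the printed proof) and `g_{𝔪,a} ∈ C^∞(M;S²𝒯*)` ((3.20)), `g_𝔪 ∈ C^∞(M;S²𝒯*)`, this is the covariant (3.21): the reading
of "similarly for the dual metrics" (H l.3749) in the direction the proof leaves implicit.
[cite: Hintz2026, Prop. 3.10 eq. (3.21) `EqKMetDiff` TeX l.3744-3749 and proof l.3751-3775 (the inversion step, computed here)] -/
theorem E_eq_neg_mul_D_mul (m a r s2 C : ℝ) (hr : r ≠ 0) (hs : s2 ≠ 0) (hμ : mu m a r ≠ 0)
    (hρ : rhoSq a r s2 ≠ 0) : E m a r s2 C = -(gKerrFar m a r s2 C * D m a r s2 C * gRef m r s2) := by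
  rw [D, Matrix.mul_sub, Matrix.sub_mul, gKerrFar_mul_gKerrInvFar m a r s2 C hr hs hμ hρ, Matrix.one_mul,
    Matrix.mul_assoc, gRefInv_mul_gRef m r s2 hr hs, Matrix.mul_one, neg_sub, E]

section CovariantCoefficients

variable (m a r s2 C : ℝ)

/-- Entries of `E` are entries of `gKerrFar` minus entries of `g_𝔪`. [folklore] -/
theorem E_apply (i j : Fin 4) : E m a r s2 C i j = Gstar m a r s2 0 1 (C / r ^ 2) i j - gRef m r s2 i j := rfl

/-- `E_{t_*t_*} = (a²sin²θ − μ)/ϱ² + (1 − 2𝔪/r) = −2𝔪a²cos²θ/(rϱ²)` — `O(r⁻³)`: the `O(1)` and `O(r⁻¹)` parts of `g_{t_*t_*}`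
are exactly those of `g_𝔪` (`μ − a²sin²θ = ϱ² − 2𝔪r`). [cite: Hintz2026, Prop. 3.10 eq. (3.21), covariant side (computed here)] -/
theorem E_tt (hr : r ≠ 0) (hρ : rhoSq a r s2 ≠ 0) :
    E m a r s2 C 0 0 = -(2 * m * a ^ 2 * (1 - s2)) / (r * rhoSq a r s2) := by
  simp only [E_apply, Gstar, gRef, Qsym00]
  field_simp
  simp only [mu, rhoSq] at *
  ring

/-- `E_{t_*r} = E_{rt_*} = 1 − (r²+a²)(μ − a²sin²θ)/(ϱ²μ) + T̃′(μ − a²sin²θ)/ϱ² = 2𝔪ra²sin²θ/(ϱ²μ) + Cr⁻²(μ − a²sin²θ)/ϱ²` — `O(r⁻²)`.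
[cite: Hintz2026, Prop. 3.10 eq. (3.21), covariant side (computed here)] -/
theorem E_tr (hr : r ≠ 0) (hμ : mu m a r ≠ 0) (hρ : rhoSq a r s2 ≠ 0) :
    E m a r s2 C 0 1 = 2 * m * r * a ^ 2 * s2 / (rhoSq a r s2 * mu m a r)
        + C / r ^ 2 * (mu m a r - a ^ 2 * s2) / rhoSq a r s2 ∧
      E m a r s2 C 1 0 = E m a r s2 C 0 1 := by
  refine ⟨?_, by simp only [E_apply, Gstar, gRef, Qsym01, Qsym10]⟩
  simp only [E_apply, Gstar, gRef, Qsym01]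
  field_simp
  simp only [mu, rhoSq] at *
  ring

/-- `E_{rr} = −a²sin²θ/μ + 2𝔪ra²sin²θ(r²+a²)/(μ²ϱ²) + 2Cr⁻²(r²+a²)(μ − a²sin²θ)/(μϱ²) − C²r⁻⁴(μ − a²sin²θ)/ϱ²` — `O(r⁻²)`
(the `O(1)` parts `ϱ²/μ` and `(r²+a²)²(μ − a²sin²θ)/(ϱ²μ²)` of the `(t̃_*)` display cancel to this order; `g_𝔪` has no `dr²`).
[cite: Hintz2026, Prop. 3.10 eq. (3.21), covariant side (computed here)] -/
theorem E_rr (hr : r ≠ 0) (hμ : mu m a r ≠ 0) (hρ : rhoSq a r s2 ≠ 0) :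
    E m a r s2 C 1 1 = -(a ^ 2 * s2) / mu m a r + 2 * m * r * a ^ 2 * s2 * (r ^ 2 + a ^ 2) / (mu m a r ^ 2 * rhoSq a r s2)
        + 2 * (C / r ^ 2) * (r ^ 2 + a ^ 2) * (mu m a r - a ^ 2 * s2) / (mu m a r * rhoSq a r s2)
        - (C / r ^ 2) ^ 2 * (mu m a r - a ^ 2 * s2) / rhoSq a r s2 := by
  simp only [E_apply, Gstar, gRef, Qsym11]
  field_simp
  simp only [mu, rhoSq] at *
  ring

/-- `E_{t_*φ} = E_{φt_*} = a sin²θ(μ − r² − a²)/ϱ² = −2𝔪r a sin²θ/ϱ² = (−2𝔪/ϱ²)·(a r sin²θ)` — coefficient `O(r⁻²)` on the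
generator `2dt_*⊗_s(aϖ)`, `ϖ = r sin²θ dφ`; no division by `a`. [cite: Hintz2026, Prop. 3.10 eq. (3.21), covariant side (computed here)] -/
theorem E_tφ (hρ : rhoSq a r s2 ≠ 0) :
    E m a r s2 C 0 3 = -(2 * m * r * a * s2) / rhoSq a r s2 ∧ E m a r s2 C 3 0 = E m a r s2 C 0 3 := by
  refine ⟨?_, by simp only [E_apply, Gstar, gRef, Qsym03, Qsym30]⟩
  simp only [E_apply, Gstar, gRef, Qsym03]
  field_simp
  simp only [mu, rhoSq] at *
  ring

/-- `E_{rφ} = E_{φr} = −2𝔪a r(r²+a²)sin²θ/(ϱ²μ) + 2𝔪aCr⁻¹sin²θ/ϱ² = (−2𝔪(r²+a²)/(ϱ²μ) + 2𝔪Cr⁻²/ϱ²)·(a r sin²θ)` — coefficient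
`O(r⁻²)` on `2dr⊗_s(aϖ)`. [cite: Hintz2026, Prop. 3.10 eq. (3.21), covariant side (computed here)] -/
theorem E_rφ (hr : r ≠ 0) (hμ : mu m a r ≠ 0) (hρ : rhoSq a r s2 ≠ 0) :
    E m a r s2 C 1 3 = -(2 * m * a * r * (r ^ 2 + a ^ 2) * s2) / (rhoSq a r s2 * mu m a r)
        + 2 * m * a * C * s2 / (r * rhoSq a r s2) ∧ E m a r s2 C 3 1 = E m a r s2 C 1 3 := by
  refine ⟨?_, by simp only [E_apply, Gstar, gRef, Qsym13, Qsym31]⟩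
  simp only [E_apply, Gstar, gRef, Qsym13]
  field_simp
  simp only [mu, rhoSq] at *
  ring

/-- Angular block: `E_{θθ} = ϱ² − r² = a²cos²θ` and `E_{φφ} = sin²θ((r²+a²)² − μa²sin²θ)/ϱ² − r²sin²θ = a²sin²θ + 2𝔪ra²sin⁴θ/ϱ²`;
equivalently the angular block of `g_{𝔪,a}` is `ϱ²(dθ² + sin²θdφ²) + (1 + 2𝔪r/ϱ²)(a sin²θ dφ)²` (see `E_generators`), smooth
across the axis since `a sin²θ dφ = a(x dy − y dx)/r²` — H l.3723 "which only requires an argument near the poles".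
[cite: Hintz2026, Prop. 3.10 eq. (3.21), covariant side, and TeX l.3723 (computed here)] -/
theorem E_angular (hρ : rhoSq a r s2 ≠ 0) :
    E m a r s2 C 2 2 = a ^ 2 * (1 - s2) ∧
      E m a r s2 C 3 3 = a ^ 2 * s2 + 2 * m * r * a ^ 2 * s2 ^ 2 / rhoSq a r s2 := by
  constructor
  · simp only [E_apply, Gstar, gRef, Qsym22, rhoSq]
    ring
  · simp only [E_apply, Gstar, gRef, Qsym33]
    field_simp
    simp only [mu, rhoSq] at *
    ring

/-- The remaining components of `E` vanish identically (`tθ`, `rθ`, `θφ` and transposes). [cite: Hintz2026, Prop. 3.10 eq. (3.21), covariant side (computed here)] -/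
theorem E_offdiag_zero :
    E m a r s2 C 0 2 = 0 ∧ E m a r s2 C 2 0 = 0 ∧ E m a r s2 C 1 2 = 0 ∧ E m a r s2 C 2 1 = 0 ∧
      E m a r s2 C 2 3 = 0 ∧ E m a r s2 C 3 2 = 0 := by
  simp only [E_apply, Gstar, gRef, Qsym02, Qsym20, Qsym12, Qsym21, Qsym23, Qsym32, sub_zero, and_self]

/-- **Exact decomposition of `E` on the covariant smooth generators.**  With `ϖ := r sin²θ dφ` (components `(0,0,0,r sin²θ)`;
`aϖ = a((x/r)dy − (y/r)dx)`) and `r²g̸ = r²(dθ² + sin²θdφ²)`: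
`E = e_tt dt_*² + e_tr·2dt_*⊗_sdr + e_rr dr² + e_tϖ·2dt_*⊗_s(aϖ) + e_rϖ·2dr⊗_s(aϖ) + e_Ω·r²g̸ + e_ϖϖ·(aϖ)²` with
`e_tt = E_tt`, `e_tr = E_tr`, `e_rr = E_rr`, `e_tϖ = −2𝔪/ϱ²`, `e_rϖ = −2𝔪(r²+a²)/(ϱ²μ) + 2𝔪Cr⁻²/ϱ²`, `e_Ω = a²cos²θ/r²`,
`e_ϖϖ = (1 + 2𝔪r/ϱ²)/r²` — as the matrix identity below (all ten entries accounted for).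
[cite: Hintz2026, Prop. 3.10 eq. (3.21), covariant side (computed here)] -/
theorem E_generators (hr : r ≠ 0) (hs : s2 ≠ 0) (hμ : mu m a r ≠ 0) (hρ : rhoSq a r s2 ≠ 0) :
    E m a r s2 C = Qsym
      (-(2 * m * a ^ 2 * (1 - s2)) / (r * rhoSq a r s2))
      (2 * m * r * a ^ 2 * s2 / (rhoSq a r s2 * mu m a r) + C / r ^ 2 * (mu m a r - a ^ 2 * s2) / rhoSq a r s2)
      0
      (-(2 * m) / rhoSq a r s2 * (a * r * s2))
      (-(a ^ 2 * s2) / mu m a r + 2 * m * r * a ^ 2 * s2 * (r ^ 2 + a ^ 2) / (mu m a r ^ 2 * rhoSq a r s2)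
        + 2 * (C / r ^ 2) * (r ^ 2 + a ^ 2) * (mu m a r - a ^ 2 * s2) / (mu m a r * rhoSq a r s2)
        - (C / r ^ 2) ^ 2 * (mu m a r - a ^ 2 * s2) / rhoSq a r s2)
      0
      ((-(2 * m * (r ^ 2 + a ^ 2)) / (rhoSq a r s2 * mu m a r) + 2 * m * C / (r ^ 2 * rhoSq a r s2)) * (a * r * s2))
      (a ^ 2 * (1 - s2) / r ^ 2 * r ^ 2)
      0
      (a ^ 2 * (1 - s2) / r ^ 2 * (r ^ 2 * s2) + (1 + 2 * m * r / rhoSq a r s2) / r ^ 2 * (a * r * s2) ^ 2) := by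
  rw [E, gKerrFar, gRef, Gstar, Qsym_sub]
  refine Qsym_ext _ _ _ _ _ _ _ _ _ _ ?_ ?_ ?_ ?_ ?_ ?_ ?_ ?_ ?_ ?_
  · field_simp
    simp only [mu, rhoSq] at *
    ring
  · field_simp
    simp only [mu, rhoSq] at *
    ring
  · ring
  · field_simp
    simp only [mu, rhoSq] at *
    ring
  · field_simp
    simp only [mu, rhoSq] at *
    ring
  · ring
  · field_simp
    simp only [mu, rhoSq] at *
    ring
  · field_simp
    simp only [mu, rhoSq] at *
    ring
  · ring
  · field_simp
    simp only [mu, rhoSq] at *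
    ring

/-! ### The `ρ = r⁻¹` dictionary for the covariant side (`c2 = a²cos²θ = a²(1 − s2)`) -/

/-- On `dt_*²`: `Fc_tt(ρ) = −2𝔪c2ρ/(1 + c2ρ²)` (so `e_tt = ρ²Fc_tt = O(ρ³)`). [cite: Hintz2026, Prop. 3.10 eq. (3.21), covariant side (computed here)] -/
def Fc_tt (m c2 ρ : ℝ) : ℝ := -(2 * m * c2 * ρ) / (1 + c2 * ρ ^ 2)
/-- On `2dt_*⊗_sdr`: `Fc_tr(ρ) = 2𝔪a²s2ρ/((1−2𝔪ρ+a²ρ²)(1+c2ρ²)) + C(1 − 2𝔪ρ + a²ρ² − a²s2ρ²)/(1+c2ρ²)`. [cite: Hintz2026, Prop. 3.10 eq. (3.21), covariant side (computed here)] -/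
def Fc_tr (m a s2 c2 C ρ : ℝ) : ℝ :=
  2 * m * a ^ 2 * s2 * ρ / ((1 - 2 * m * ρ + a ^ 2 * ρ ^ 2) * (1 + c2 * ρ ^ 2))
    + C * (1 - 2 * m * ρ + a ^ 2 * ρ ^ 2 - a ^ 2 * s2 * ρ ^ 2) / (1 + c2 * ρ ^ 2)
/-- On `dr²`: `Fc_rr(ρ) = −a²s2/(1−2𝔪ρ+a²ρ²) + 2𝔪a²s2ρ(1+a²ρ²)/((1−2𝔪ρ+a²ρ²)²(1+c2ρ²))
+ 2C(1+a²ρ²)(1−2𝔪ρ+a²ρ²−a²s2ρ²)/((1−2𝔪ρ+a²ρ²)(1+c2ρ²)) − C²ρ²(1−2𝔪ρ+a²ρ²−a²s2ρ²)/(1+c2ρ²)`. [cite: Hintz2026, Prop. 3.10 eq. (3.21), covariant side (computed here)] -/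
def Fc_rr (m a s2 c2 C ρ : ℝ) : ℝ :=
  -(a ^ 2 * s2) / (1 - 2 * m * ρ + a ^ 2 * ρ ^ 2)
    + 2 * m * a ^ 2 * s2 * ρ * (1 + a ^ 2 * ρ ^ 2) / ((1 - 2 * m * ρ + a ^ 2 * ρ ^ 2) ^ 2 * (1 + c2 * ρ ^ 2))
    + 2 * C * (1 + a ^ 2 * ρ ^ 2) * (1 - 2 * m * ρ + a ^ 2 * ρ ^ 2 - a ^ 2 * s2 * ρ ^ 2)
        / ((1 - 2 * m * ρ + a ^ 2 * ρ ^ 2) * (1 + c2 * ρ ^ 2))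
    - C ^ 2 * ρ ^ 2 * (1 - 2 * m * ρ + a ^ 2 * ρ ^ 2 - a ^ 2 * s2 * ρ ^ 2) / (1 + c2 * ρ ^ 2)
/-- On `2dt_*⊗_s(aϖ)`: `Fc_tϖ(ρ) = −2𝔪/(1 + c2ρ²)`. [cite: Hintz2026, Prop. 3.10 eq. (3.21), covariant side (computed here)] -/
def Fc_tϖ (m c2 ρ : ℝ) : ℝ := -(2 * m) / (1 + c2 * ρ ^ 2)
/-- On `2dr⊗_s(aϖ)`: `Fc_rϖ(ρ) = −2𝔪(1+a²ρ²)/((1−2𝔪ρ+a²ρ²)(1+c2ρ²)) + 2𝔪Cρ²/(1+c2ρ²)`. [cite: Hintz2026, Prop. 3.10 eq. (3.21), covariant side (computed here)] -/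
def Fc_rϖ (m a c2 C ρ : ℝ) : ℝ :=
  -(2 * m * (1 + a ^ 2 * ρ ^ 2)) / ((1 - 2 * m * ρ + a ^ 2 * ρ ^ 2) * (1 + c2 * ρ ^ 2))
    + 2 * m * C * ρ ^ 2 / (1 + c2 * ρ ^ 2)
/-- On `r²g̸`: `Fc_Ω = c2` (constant in `ρ`). [cite: Hintz2026, Prop. 3.10 eq. (3.21), covariant side (computed here)] -/
def Fc_Ω (c2 : ℝ) : ℝ := c2
/-- On `(aϖ)²`: `Fc_ϖϖ(ρ) = 1 + 2𝔪ρ/(1 + c2ρ²)`. [cite: Hintz2026, Prop. 3.10 eq. (3.21), covariant side (computed here)] -/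
def Fc_ϖϖ (m c2 ρ : ℝ) : ℝ := 1 + 2 * m * ρ / (1 + c2 * ρ ^ 2)

/-- The `Fc`'s at `ρ = 0` (`r = ∞`) are finite numbers: `0, C, 2C − a²s2, −2𝔪, −2𝔪, c2, 1`. [cite: Hintz2026, Prop. 3.10 eq. (3.21) (the r⁻² claim, covariant side; computed here)] -/
theorem Fc_values_at_zero (m a s2 c2 C : ℝ) :
    Fc_tt m c2 0 = 0 ∧ Fc_tr m a s2 c2 C 0 = C ∧ Fc_rr m a s2 c2 C 0 = 2 * C - a ^ 2 * s2 ∧ Fc_tϖ m c2 0 = -(2 * m) ∧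
      Fc_rϖ m a c2 C 0 = -(2 * m) ∧ Fc_Ω c2 = c2 ∧ Fc_ϖϖ m c2 0 = 1 := by
  simp only [Fc_tt, Fc_tr, Fc_rr, Fc_tϖ, Fc_rϖ, Fc_Ω, Fc_ϖϖ]
  norm_num
  ring

/-- **The seven coefficients of `E_generators` ARE `ρ²·Fc(ρ)` at `ρ = r⁻¹`** (`r > 0`, `μ ≠ 0`, `ϱ² ≠ 0`, `sin²θ ≠ 0`):
`e_tt = ρ²Fc_tt`, `e_tr = ρ²Fc_tr`, `e_rr = ρ²Fc_rr`, `e_tϖ = ρ²Fc_tϖ`, `e_rϖ = ρ²Fc_rϖ`, `e_Ω = ρ²Fc_Ω`, `e_ϖϖ = ρ²Fc_ϖϖ` —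
every coefficient of `g_{𝔪,a} − g_𝔪` on the covariant smooth generators is `r⁻² ×` a rational function of `ρ` regular at
`ρ = 0` with the denominators of §3 (`den_pos`, `denMu_pos`): the covariant (3.21) at the level of its algebra.
[cite: Hintz2026, Prop. 3.10 eq. (3.21) `EqKMetDiff` TeX l.3744-3747 (covariant side; computed here)] -/
theorem E_rho_forms (ρ : ℝ) (hρ0 : 0 < ρ) (h : r * ρ = 1) (hμ : mu m a r ≠ 0) (hϱ : rhoSq a r s2 ≠ 0) :
    -(2 * m * a ^ 2 * (1 - s2)) / (r * rhoSq a r s2) = ρ ^ 2 * Fc_tt m (a ^ 2 * (1 - s2)) ρ ∧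
      2 * m * r * a ^ 2 * s2 / (rhoSq a r s2 * mu m a r) + C / r ^ 2 * (mu m a r - a ^ 2 * s2) / rhoSq a r s2
        = ρ ^ 2 * Fc_tr m a s2 (a ^ 2 * (1 - s2)) C ρ ∧
      -(a ^ 2 * s2) / mu m a r + 2 * m * r * a ^ 2 * s2 * (r ^ 2 + a ^ 2) / (mu m a r ^ 2 * rhoSq a r s2)
          + 2 * (C / r ^ 2) * (r ^ 2 + a ^ 2) * (mu m a r - a ^ 2 * s2) / (mu m a r * rhoSq a r s2)
          - (C / r ^ 2) ^ 2 * (mu m a r - a ^ 2 * s2) / rhoSq a r s2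
        = ρ ^ 2 * Fc_rr m a s2 (a ^ 2 * (1 - s2)) C ρ ∧
      -(2 * m) / rhoSq a r s2 = ρ ^ 2 * Fc_tϖ m (a ^ 2 * (1 - s2)) ρ ∧
      -(2 * m * (r ^ 2 + a ^ 2)) / (rhoSq a r s2 * mu m a r) + 2 * m * C / (r ^ 2 * rhoSq a r s2)
        = ρ ^ 2 * Fc_rϖ m a (a ^ 2 * (1 - s2)) C ρ ∧
      a ^ 2 * (1 - s2) / r ^ 2 = ρ ^ 2 * Fc_Ω (a ^ 2 * (1 - s2)) ∧
      (1 + 2 * m * r / rhoSq a r s2) / r ^ 2 = ρ ^ 2 * Fc_ϖϖ m (a ^ 2 * (1 - s2)) ρ := by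
  have _hρ : ρ ≠ 0 := hρ0.ne'
  have _h1 : 1 + a ^ 2 * (1 - s2) * ρ ^ 2 ≠ 0 := by
    intro hz; apply hϱ; rw [rhoSq_rho a r s2 ρ h, hz, mul_zero]
  have _h2 : 1 - 2 * m * ρ + a ^ 2 * ρ ^ 2 ≠ 0 := by
    intro hz; apply hμ; rw [mu_rho m a r ρ h, hz, mul_zero]
  have hr : r = ρ⁻¹ := eq_inv_of_mul_eq_one_left h
  subst hr
  simp only [mu, rhoSq, Fc_tt, Fc_tr, Fc_rr, Fc_tϖ, Fc_rϖ, Fc_Ω, Fc_ϖϖ] at *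
  refine ⟨?_, ?_, ?_, ?_, ?_, ?_, ?_⟩ <;> field_simp

end CovariantCoefficients

/-! ## 6. (3.22) `EqKMetaExpr`: the Euclidean identities behind "smooth dependence on `𝔞 ∈ ℝ³`" (v3)

H l.3753–3758: at a point `x ∈ ℝ³` with polar coordinates `(r, θ, φ)` adapted to `𝔞` (north pole `θ = 0` at `𝔞/|𝔞|`,
Def. 3.8, H l.3714; `a = |𝔞|`): `a∂_φ = ∇_{𝔞×x}`, `a cosθ = 𝔞·x/|x|`, `a²sin²θ = |𝔞|² − (𝔞·x/|x|)²`.  Here with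
`𝔞 = (0, 0, a)` (any real `a`; `|𝔞|² = a²`) and `x = r(sinθcosφ, sinθsinφ, cosθ)`, `r > 0`.  The right-hand sides are
polynomial in `𝔞` and in `x/|x|`, which is the "smooth dependence on `𝔞 ∈ ℝ³`" (H l.3763) near `𝔞 = 0` as well. -/

/-- Cartesian coordinates `x = r(sinθcosφ, sinθsinφ, cosθ)` of the point with polar coordinates `(r, θ, φ)` adapted to
`𝔞 = a·e₃`. [cite: Hintz2026, Def. 3.8 `DefKMetcM` TeX l.3714 and Prop. 3.10 proof l.3759 (the convention; transcription)] -/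
def cart (r θ φ : ℝ) : Fin 3 → ℝ := ![r * Real.sin θ * Real.cos φ, r * Real.sin θ * Real.sin φ, r * Real.cos θ]

/-- The angular-momentum vector `𝔞 = (0, 0, a)` along the north pole. [cite: Hintz2026, Def. 3.8 `DefKMetcM` TeX l.3714 (transcription)] -/
def avec (a : ℝ) : Fin 3 → ℝ := ![0, 0, a]

/-- `∂_φx = (−r sinθ sinφ, r sinθ cosφ, 0)`: the Cartesian components of the coordinate vector field `∂_φ`. [folklore] -/
def dphiCart (r θ φ : ℝ) : Fin 3 → ℝ := ![-(r * Real.sin θ * Real.sin φ), r * Real.sin θ * Real.cos φ, 0]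

/-- `dphiCart` IS `∂_φ` of `cart`. [folklore] -/
theorem hasDerivAt_cart_phi (r θ φ : ℝ) : HasDerivAt (fun φ' => cart r θ φ') (dphiCart r θ φ) φ := by
  refine hasDerivAt_pi.2 fun i => ?_
  fin_cases i
  · simpa [cart, dphiCart] using (Real.hasDerivAt_cos φ).const_mul (r * Real.sin θ)
  · simpa [cart, dphiCart] using (Real.hasDerivAt_sin φ).const_mul (r * Real.sin θ)
  · simpa [cart, dphiCart] using hasDerivAt_const φ (r * Real.cos θ)

/-- **(3.22), first identity**: `a·∂_φx = 𝔞 × x` — so the vector field `a∂_φ` is `∇_{𝔞×x}`, linear in `𝔞`.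
[cite: Hintz2026, Prop. 3.10 proof eq. (3.22) `EqKMetaExpr` TeX l.3755 (reproduced)] -/
theorem eqKMetaExpr_dphi (a r θ φ : ℝ) : a • dphiCart r θ φ = avec a ⨯₃ cart r θ φ := by
  rw [cross_apply]
  ext i
  fin_cases i <;> simp [dphiCart, avec, cart]

/-- Chain-rule form of the first identity: for `f` differentiable at `x`, `a·∂_φ(f∘x) = df_x(𝔞 × x)`.
[cite: Hintz2026, Prop. 3.10 proof eq. (3.22) `EqKMetaExpr` TeX l.3755 (reproduced)] -/
theorem eqKMetaExpr_dphi_chain (a r θ φ : ℝ) {f : (Fin 3 → ℝ) → ℝ} {f' : (Fin 3 → ℝ) →L[ℝ] ℝ}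
    (hf : HasFDerivAt f f' (cart r θ φ)) :
    HasDerivAt (fun φ' => f (cart r θ φ')) (f' (dphiCart r θ φ)) φ ∧
      a * f' (dphiCart r θ φ) = f' (avec a ⨯₃ cart r θ φ) := by
  refine ⟨?_, by rw [← eqKMetaExpr_dphi, map_smul, smul_eq_mul]⟩
  have h := HasFDerivAt.comp_hasDerivAt (l := f) (l' := f') (f := fun φ' => cart r θ φ') (x := φ) hf
    (hasDerivAt_cart_phi r θ φ)
  exact h

/-- `|x|² = r²`. [folklore] -/
theorem cart_dot_self (r θ φ : ℝ) : cart r θ φ ⬝ᵥ cart r θ φ = r ^ 2 := by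
  have h1 := Real.sin_sq_add_cos_sq θ
  have h2 := Real.sin_sq_add_cos_sq φ
  simp only [cart, vec3_dotProduct, Matrix.cons_val_zero, Matrix.cons_val_one, Matrix.cons_val_two,
    Matrix.head_cons, Matrix.tail_cons]
  linear_combination r ^ 2 * h1 + r ^ 2 * Real.sin θ ^ 2 * h2

/-- `|x| = r` for `r ≥ 0`. [folklore] -/
theorem norm_cart (r θ φ : ℝ) (hr : 0 ≤ r) : Real.sqrt (cart r θ φ ⬝ᵥ cart r θ φ) = r := by
  rw [cart_dot_self, Real.sqrt_sq hr]

/-- `𝔞·x = r·(a cosθ)`. [folklore] -/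
theorem avec_dot_cart (a r θ φ : ℝ) : avec a ⬝ᵥ cart r θ φ = r * (a * Real.cos θ) := by
  simp only [avec, cart, vec3_dotProduct, Matrix.cons_val_zero, Matrix.cons_val_one, Matrix.cons_val_two,
    Matrix.head_cons, Matrix.tail_cons]
  ring

/-- `|𝔞|² = a²`. [folklore] -/
theorem avec_dot_self (a : ℝ) : avec a ⬝ᵥ avec a = a ^ 2 := by
  simp only [avec, vec3_dotProduct, Matrix.cons_val_zero, Matrix.cons_val_one, Matrix.cons_val_two,
    Matrix.head_cons, Matrix.tail_cons]
  ring

/-- **(3.22), second identity**: `a cosθ = 𝔞·x/|x|` (`r > 0`). [cite: Hintz2026, Prop. 3.10 proof eq. (3.22) `EqKMetaExpr` TeX l.3756 (reproduced)] -/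
theorem eqKMetaExpr_cos (a r θ φ : ℝ) (hr : 0 < r) :
    a * Real.cos θ = avec a ⬝ᵥ cart r θ φ / Real.sqrt (cart r θ φ ⬝ᵥ cart r θ φ) := by
  rw [norm_cart r θ φ hr.le, avec_dot_cart, mul_div_cancel_left₀ _ hr.ne']

/-- **(3.22), third identity**: `a²sin²θ = |𝔞|² − (𝔞·x/|x|)²` (`r > 0`). [cite: Hintz2026, Prop. 3.10 proof eq. (3.22) `EqKMetaExpr` TeX l.3757 (reproduced)] -/
theorem eqKMetaExpr_sin2 (a r θ φ : ℝ) (hr : 0 < r) :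
    a ^ 2 * Real.sin θ ^ 2
      = avec a ⬝ᵥ avec a - (avec a ⬝ᵥ cart r θ φ / Real.sqrt (cart r θ φ ⬝ᵥ cart r θ φ)) ^ 2 := by
  rw [norm_cart r θ φ hr.le, avec_dot_cart, mul_div_cancel_left₀ _ hr.ne', avec_dot_self]
  linear_combination a ^ 2 * Real.sin_sq_add_cos_sq θ

end Literature.Geometry.Lorentzian.Hintz2026.KerrDualMetricForm

end
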